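import Literature.Analysis.FluidPDE.PeriodicLerayTestPeriodization
import Literature.Analysis.FluidPDE.PeriodicLerayLineIdentities
import Literature.Analysis.FluidPDE.PeriodicLerayLinePolarization
import Literature.Analysis.FluidPDE.PeriodicLerayMollifiedClasses
import Literature.Analysis.FluidPDE.PeriodicLerayGalerkinSystem
import Literature.Analysis.FluidPDE.LocalLeraySlabPairing
import Literature.Analysis.FluidPDE.StokesLocalEnergyEquality
import Literature.Analysis.FluidPDE.MollifiedLerayDistributional
import HarnessLib

/-!
# [BT1] the dilation and drift transport identities, polarized against vector test fields

Analysis/FluidPDE proof file (theorems only; no definitions, no named facts) in the DAG below the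
named fact `Literature.Analysis.FluidPDE.bradshawTsai2017_thm_2_4_mollified`
(`PeriodicLerayExistence.lean`; Bradshaw–Tsai, Ann. Henri Poincaré 18 (2017) = arXiv:1510.07504
[BT1], proof of Thm 2.4). For a field `U` with an `L²_loc` weak spatial gradient `G` on
`ℝ × ℝ³`, a `C¹` divergence-free profile `W` and a bounded, `C¹`-in-space, (a.e.) divergence-free
drift `V` (`V = η_ε * U` in [BT1]) — the two identities by which the lower-order terms of the
line weak form / the distributional formulation are moved between `U` and the test field, and
their two uses in the proof of Thm 2.4 (`veryWeak_of_lineWeakForm`: the line weak form implies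
the very weak form fed to `distributional_of_veryWeak_slices`; `stokesForm_of_distributional`:
the distributional clause implies the Stokes form fed to the local energy equality):

* `integral_inner_apply_self_polarized` / `integral_inner_apply_drift_polarized` — the
  dilation and drift transport identities tested against a vector test field `ψ`:
  `∫∫⟪G y, ψ⟫ + ∫∫⟪Dψ y, U⟫ = −3 ∫∫⟪U, ψ⟫`, `∫∫⟪G b, ψ⟫ + ∫∫⟪Dψ b, U⟫ = 0` (`b = W + V`),
  from `HasWeakSpatialGradientOn.integral_inner_apply_field_polarized`
  (`PeriodicLerayLinePolarization`) with the cut-off fields `X = θ y`, `X = θ b`, `θ ≡ 1` near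
  `supp ψ`.

## References

* Z. Bradshaw, T.-P. Tsai, Ann. Henri Poincaré 18 (2017) = arXiv:1510.07504, §2 and proof of
  Thm 2.4 [BradshawTsai2017AHP].
* L. C. Evans, *Partial differential equations*, 2nd ed., §5.2.3 Thm. 1 (iv) [Evans2010].
-/

noncomputable section

open MeasureTheory Set Function Filter Topology TopologicalSpace Metric
open scoped NNReal ENNReal InnerProductSpace RealInnerProductSpace Laplacian

namespace Literature.Analysis.FluidPDE

namespace BradshawTsai2017

section Polarized

variable {U W V : ℝ → EuclideanSpace ℝ (Fin 3) → EuclideanSpace ℝ (Fin 3)}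
  {G : ℝ → EuclideanSpace ℝ (Fin 3) → EuclideanSpace ℝ (Fin 3) →L[ℝ] EuclideanSpace ℝ (Fin 3)}

/-- `div (y ↦ y) = 3` on `ℝ³`. [folklore] -/
theorem divergence_id_eq_three (y : EuclideanSpace ℝ (Fin 3)) :
    VectorCalculus.divergence (fun x : EuclideanSpace ℝ (Fin 3) => x) y = 3 := by
  rw [divergence_eq_sum_inner_fderiv (stdOrthonormalBasis ℝ (EuclideanSpace ℝ (Fin 3)))]
  have e : fderiv ℝ (fun x : EuclideanSpace ℝ (Fin 3) => x) y = ContinuousLinearMap.id ℝ _ := fderiv_id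
  simp only [e, ContinuousLinearMap.id_apply, real_inner_self_eq_norm_sq,
    (stdOrthonormalBasis ℝ (EuclideanSpace ℝ (Fin 3))).orthonormal.1, one_pow, Finset.sum_const,
    Finset.card_univ, nsmul_eq_mul, mul_one]
  rw [← Module.finrank_eq_card_basis (stdOrthonormalBasis ℝ (EuclideanSpace ℝ (Fin 3))).toBasis]
  simp

/-- **The dilation transport identity, polarized**: for a field `U` with an `L²_loc` weak
spatial gradient `G` on `ℝ × ℝ³` and a vector test field `ψ`,
`∫∫ ⟪G y, ψ⟫ + ∫∫ ⟪Dψ y, U⟫ = −3 ∫∫ ⟪U, ψ⟫` (the weak product rule for `⟪U, ψ⟫` along `X = y`,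
`div X = 3`). [cite: Evans2010, §5.2.3 Thm. 1 (iv)] -/
theorem integral_inner_apply_self_polarized
    (hG : HasWeakSpatialGradientOn (⊤ : Opens (ℝ × EuclideanSpace ℝ (Fin 3))) U G)
    (hU2 : LocallyIntegrable (fun z : ℝ × EuclideanSpace ℝ (Fin 3) => ‖U z.1 z.2‖ ^ 2) volume)
    (hG2 : LocallyIntegrable (fun z : ℝ × EuclideanSpace ℝ (Fin 3) => frobeniusNormSq (G z.1 z.2)) volume)
    {ψ : ℝ → EuclideanSpace ℝ (Fin 3) → EuclideanSpace ℝ (Fin 3)}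
    (hψ : IsSpaceTimeTestOn (⊤ : Opens (ℝ × EuclideanSpace ℝ (Fin 3))) ψ) :
    (∫ z : ℝ × EuclideanSpace ℝ (Fin 3), ⟪G z.1 z.2 z.2, ψ z.1 z.2⟫) +
      ∫ z : ℝ × EuclideanSpace ℝ (Fin 3), ⟪fderiv ℝ (ψ z.1) z.2 z.2, U z.1 z.2⟫ =
      -3 * ∫ z : ℝ × EuclideanSpace ℝ (Fin 3), ⟪U z.1 z.2, ψ z.1 z.2⟫ := by
  set K : Set (ℝ × EuclideanSpace ℝ (Fin 3)) := tsupport (uncurry ψ) with hK_def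
  have hK : IsCompact K := hψ.hasCompactSupport
  obtain ⟨θ, R, hθ, hR0, hKR, hθ1, hθg⟩ := exists_spaceTime_cutoff_eq_one hK
  obtain ⟨Cθ, Cg, hCθ0, hCg0, hCθ, hCg, cgθ⟩ := hθ.exists_bound_self_and_gradient
  have cθ : Continuous fun z : ℝ × EuclideanSpace ℝ (Fin 3) => θ z.1 z.2 := hθ.contDiff.continuous
  set K' : Set (ℝ × EuclideanSpace ℝ (Fin 3)) := tsupport (uncurry θ) with hK'_def
  have hK' : IsCompact K' := hθ.hasCompactSupport
  obtain ⟨RK, hRK⟩ := hK'.isBounded.exists_norm_le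
  -- the field `X = θ y`
  set X : ℝ → EuclideanSpace ℝ (Fin 3) → EuclideanSpace ℝ (Fin 3) := fun s y => θ s y • y with hX
  have hXK : ∀ s y, (s, y) ∉ K' → X s y = 0 := fun s y h => by
    show θ s y • y = 0
    rw [show θ s y = 0 from (image_eq_zero_of_notMem_tsupport h : uncurry θ (s, y) = 0), zero_smul]
  have hθs : ∀ s, ContDiff ℝ 1 (θ s) := fun s =>
    (hθ.contDiff.comp (contDiff_prodMk_right s)).of_le (by exact_mod_cast le_top)
  have hX1 : ∀ s, ContDiff ℝ 1 (X s) := fun s => (hθs s).smul contDiff_id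
  have hXm : AEStronglyMeasurable (uncurry X) (volume : Measure (ℝ × EuclideanSpace ℝ (Fin 3))) :=
    (cθ.smul continuous_snd).aestronglyMeasurable
  have hdiv : ∀ z : ℝ × EuclideanSpace ℝ (Fin 3), VectorCalculus.divergence (X z.1) z.2 =
      θ z.1 z.2 * 3 + ⟪z.2, gradient (θ z.1) z.2⟫ := fun z => by
    show VectorCalculus.divergence (fun y => θ z.1 y • (fun x : EuclideanSpace ℝ (Fin 3) => x) y) z.2 = _
    rw [divergence_smul_apply (u := fun x : EuclideanSpace ℝ (Fin 3) => x)
      (((hθs z.1).differentiable one_ne_zero) z.2) differentiableAt_fun_id, divergence_id_eq_three]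
  have hdm : AEStronglyMeasurable (fun z : ℝ × EuclideanSpace ℝ (Fin 3) =>
      VectorCalculus.divergence (X z.1) z.2) (volume : Measure (ℝ × EuclideanSpace ℝ (Fin 3))) := by
    have e : (fun z : ℝ × EuclideanSpace ℝ (Fin 3) => VectorCalculus.divergence (X z.1) z.2) =
        fun z => θ z.1 z.2 * 3 + ⟪z.2, gradient (θ z.1) z.2⟫ := funext hdiv
    rw [e]
    exact ((cθ.mul continuous_const).add (continuous_snd.inner cgθ)).aestronglyMeasurable
  have hgradK : ∀ z : ℝ × EuclideanSpace ℝ (Fin 3), gradient (θ z.1) z.2 ≠ 0 → z ∈ K' := by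
    intro z hz
    by_contra h
    have hev : (uncurry θ) =ᶠ[𝓝 z] fun _ => 0 := by
      filter_upwards [(isClosed_tsupport _).isOpen_compl.mem_nhds h] with w hw
      exact image_eq_zero_of_notMem_tsupport hw
    have hz' : (fun y => θ z.1 y) =ᶠ[𝓝 z.2] fun _ => 0 := by
      have hc : ContinuousAt (fun y => ((z.1, y) : ℝ × EuclideanSpace ℝ (Fin 3))) z.2 :=
        (Continuous.prodMk_right z.1).continuousAt
      exact hc.eventually (show ∀ᶠ w in 𝓝 ((z.1, z.2) : ℝ × EuclideanSpace ℝ (Fin 3)), uncurry θ w = 0 from hev)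
    apply hz
    rw [gradient, hz'.fderiv_eq, fderiv_fun_const, Pi.zero_apply, map_zero]
  have hCX : ∀ᵐ z : ℝ × EuclideanSpace ℝ (Fin 3), ‖X z.1 z.2‖ ≤ Cθ * |RK| := ae_of_all _ fun z => by
    by_cases hz : z ∈ K'
    · simp only [hX, norm_smul]
      exact mul_le_mul (hCθ z.1 z.2) (((norm_snd_le z).trans (hRK z hz)).trans (le_abs_self _))
        (norm_nonneg _) hCθ0
    · rw [hXK z.1 z.2 hz, norm_zero]; positivity
  have hCd : ∀ᵐ z : ℝ × EuclideanSpace ℝ (Fin 3), |VectorCalculus.divergence (X z.1) z.2| ≤ Cθ * 3 + |RK| * Cg :=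
      ae_of_all _ fun z => by
    rw [hdiv z]
    have h1 : |θ z.1 z.2 * 3| ≤ Cθ * 3 := by
      rw [abs_mul, abs_of_pos (by norm_num : (0:ℝ) < 3)]
      exact mul_le_mul_of_nonneg_right ((Real.norm_eq_abs _).symm.le.trans (hCθ z.1 z.2)) (by norm_num)
    have h2 : |⟪z.2, gradient (θ z.1) z.2⟫| ≤ |RK| * Cg := by
      by_cases hg0 : gradient (θ z.1) z.2 = 0
      · rw [hg0, inner_zero_right, abs_zero]; positivity
      · have hz := hgradK z hg0
        calc |⟪z.2, gradient (θ z.1) z.2⟫| ≤ ‖z.2‖ * ‖gradient (θ z.1) z.2‖ := abs_real_inner_le_norm _ _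
          _ ≤ |RK| * Cg := mul_le_mul (((norm_snd_le z).trans (hRK z hz)).trans (le_abs_self _))
              (hCg z.1 z.2) (norm_nonneg _) (abs_nonneg _)
    exact (abs_add_le _ _).trans (add_le_add h1 h2)
  -- the polarized identity for `X`
  have hP := hG.integral_inner_apply_field_polarized hU2 hG2 hψ hK' hXK hX1 hXm hdm hCX hCd
  -- replace `X` by `y` on the support of `ψ`
  have hψ0 : ∀ z : ℝ × EuclideanSpace ℝ (Fin 3), z ∉ K → ψ z.1 z.2 = 0 ∧ fderiv ℝ (ψ z.1) z.2 = 0 := fun z hz =>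
    ⟨(image_eq_zero_of_notMem_tsupport hz : uncurry ψ z = 0),
      IsSpaceTimeTestOn.fderiv_slice_eq_zero_of_notMem hz⟩
  have hXy : ∀ z ∈ K, X z.1 z.2 = z.2 := fun z hz => by
    simp only [hX, hθ1 z (ball_subset_closedBall (hKR hz)), one_smul]
  have hdiv3 : ∀ z ∈ K, VectorCalculus.divergence (X z.1) z.2 = 3 := fun z hz => by
    rw [hdiv z, hθ1 z (ball_subset_closedBall (hKR hz)), hθg z (hKR hz), inner_zero_right]; ring
  have e1 : (∫ z : ℝ × EuclideanSpace ℝ (Fin 3), ⟪G z.1 z.2 (X z.1 z.2), ψ z.1 z.2⟫) = ∫ z : ℝ × EuclideanSpace ℝ (Fin 3), ⟪G z.1 z.2 z.2, ψ z.1 z.2⟫ := by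
    refine integral_congr_ae (ae_of_all _ fun z => ?_)
    dsimp only
    by_cases hz : z ∈ K
    · rw [hXy z hz]
    · simp only [(hψ0 z hz).1, inner_zero_right]
  have e2 : (∫ z : ℝ × EuclideanSpace ℝ (Fin 3), ⟪fderiv ℝ (ψ z.1) z.2 (X z.1 z.2), U z.1 z.2⟫) =
      ∫ z : ℝ × EuclideanSpace ℝ (Fin 3), ⟪fderiv ℝ (ψ z.1) z.2 z.2, U z.1 z.2⟫ := by
    refine integral_congr_ae (ae_of_all _ fun z => ?_)
    dsimp only
    by_cases hz : z ∈ K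
    · rw [hXy z hz]
    · rw [(hψ0 z hz).2]; rfl
  have e3 : (∫ z : ℝ × EuclideanSpace ℝ (Fin 3), ⟪U z.1 z.2, ψ z.1 z.2⟫ * VectorCalculus.divergence (X z.1) z.2) =
      3 * ∫ z : ℝ × EuclideanSpace ℝ (Fin 3), ⟪U z.1 z.2, ψ z.1 z.2⟫ := by
    rw [← integral_const_mul]
    refine integral_congr_ae (ae_of_all _ fun z => ?_)
    dsimp only
    by_cases hz : z ∈ K
    · rw [hdiv3 z hz]; ring
    · simp only [(hψ0 z hz).1, inner_zero_right, zero_mul, mul_zero]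
  rw [e1, e2, e3] at hP
  linarith

variable (W V) in
/-- **The drift transport identity, polarized**: for a field `U` with an `L²_loc` weak spatial
gradient `G` on `ℝ × ℝ³`, a `C¹` divergence-free profile `W`, a bounded, jointly measurable drift
`V`, `C¹` in space with `div V = 0` a.e., and a vector test field `ψ`,
`∫∫ ⟪G (W + V), ψ⟫ + ∫∫ ⟪Dψ (W + V), U⟫ = 0` (the weak product rule along `b = W + V`,
`div b = 0`). [cite: Evans2010, §5.2.3 Thm. 1 (iv)] -/
theorem integral_inner_apply_drift_polarized
    (hG : HasWeakSpatialGradientOn (⊤ : Opens (ℝ × EuclideanSpace ℝ (Fin 3))) U G)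
    (hU2 : LocallyIntegrable (fun z : ℝ × EuclideanSpace ℝ (Fin 3) => ‖U z.1 z.2‖ ^ 2) volume)
    (hG2 : LocallyIntegrable (fun z : ℝ × EuclideanSpace ℝ (Fin 3) => frobeniusNormSq (G z.1 z.2)) volume)
    (hW : ContDiff ℝ 1 (uncurry W)) (hdivW : ∀ s, VectorCalculus.IsDivFree (W s))
    (hV1 : ∀ s, ContDiff ℝ 1 (V s)) (hVm : AEStronglyMeasurable (uncurry V) volume) {CV : ℝ}
    (hVb : ∀ s y, ‖V s y‖ ≤ CV)
    (hdivV : ∀ᵐ z : ℝ × EuclideanSpace ℝ (Fin 3), VectorCalculus.divergence (V z.1) z.2 = 0)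
    {ψ : ℝ → EuclideanSpace ℝ (Fin 3) → EuclideanSpace ℝ (Fin 3)}
    (hψ : IsSpaceTimeTestOn (⊤ : Opens (ℝ × EuclideanSpace ℝ (Fin 3))) ψ) :
    (∫ z : ℝ × EuclideanSpace ℝ (Fin 3), ⟪G z.1 z.2 (W z.1 z.2 + V z.1 z.2), ψ z.1 z.2⟫) +
      ∫ z : ℝ × EuclideanSpace ℝ (Fin 3), ⟪fderiv ℝ (ψ z.1) z.2 (W z.1 z.2 + V z.1 z.2), U z.1 z.2⟫ = 0 := by
  set K : Set (ℝ × EuclideanSpace ℝ (Fin 3)) := tsupport (uncurry ψ) with hK_def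
  have hK : IsCompact K := hψ.hasCompactSupport
  obtain ⟨θ, R, hθ, hR0, hKR, hθ1, hθg⟩ := exists_spaceTime_cutoff_eq_one hK
  obtain ⟨Cθ, Cg, hCθ0, hCg0, hCθ, hCg, cgθ⟩ := hθ.exists_bound_self_and_gradient
  have cθ : Continuous fun z : ℝ × EuclideanSpace ℝ (Fin 3) => θ z.1 z.2 := hθ.contDiff.continuous
  set K' : Set (ℝ × EuclideanSpace ℝ (Fin 3)) := tsupport (uncurry θ) with hK'_def
  have hK' : IsCompact K' := hθ.hasCompactSupport
  have cW : Continuous fun z : ℝ × EuclideanSpace ℝ (Fin 3) => W z.1 z.2 := hW.continuous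
  obtain ⟨MW, hMW⟩ := hK'.exists_bound_of_continuousOn cW.continuousOn
  have hCV0 : 0 ≤ CV := (norm_nonneg _).trans (hVb 0 0)
  have hWs : ∀ s, ContDiff ℝ 1 (W s) := fun s => hW.comp (contDiff_prodMk_right s)
  have hθs : ∀ s, ContDiff ℝ 1 (θ s) := fun s =>
    (hθ.contDiff.comp (contDiff_prodMk_right s)).of_le (by exact_mod_cast le_top)
  -- the field `X = θ b`
  set X : ℝ → EuclideanSpace ℝ (Fin 3) → EuclideanSpace ℝ (Fin 3) :=
    fun s y => θ s y • (W s y + V s y) with hX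
  have hXK : ∀ s y, (s, y) ∉ K' → X s y = 0 := fun s y h => by
    show θ s y • (W s y + V s y) = 0
    rw [show θ s y = 0 from (image_eq_zero_of_notMem_tsupport h : uncurry θ (s, y) = 0), zero_smul]
  have hX1 : ∀ s, ContDiff ℝ 1 (X s) := fun s => (hθs s).smul ((hWs s).add (hV1 s))
  have hXm : AEStronglyMeasurable (uncurry X) (volume : Measure (ℝ × EuclideanSpace ℝ (Fin 3))) :=
    cθ.aestronglyMeasurable.smul (cW.aestronglyMeasurable.add hVm)
  have hdiv : ∀ z : ℝ × EuclideanSpace ℝ (Fin 3), VectorCalculus.divergence (X z.1) z.2 =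
      θ z.1 z.2 * VectorCalculus.divergence (V z.1) z.2 + ⟪W z.1 z.2 + V z.1 z.2, gradient (θ z.1) z.2⟫ := by
    intro z
    have hWd := ((hWs z.1).differentiable one_ne_zero) z.2
    have hVd := ((hV1 z.1).differentiable one_ne_zero) z.2
    have hbd : DifferentiableAt ℝ (fun y => W z.1 y + V z.1 y) z.2 := hWd.add hVd
    show VectorCalculus.divergence (fun y => θ z.1 y • (fun y => W z.1 y + V z.1 y) y) z.2 = _
    rw [divergence_smul_apply (u := fun y => W z.1 y + V z.1 y)
      (((hθs z.1).differentiable one_ne_zero) z.2) hbd]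
    have hadd := divergence_add_apply (v := W z.1) (w := V z.1) (x := z.2) hWd hVd
    rw [hadd, hdivW z.1 z.2, zero_add]
  have hgradK : ∀ z : ℝ × EuclideanSpace ℝ (Fin 3), gradient (θ z.1) z.2 ≠ 0 → z ∈ K' := by
    intro z hz
    by_contra h
    have hev : (uncurry θ) =ᶠ[𝓝 z] fun _ => 0 := by
      filter_upwards [(isClosed_tsupport _).isOpen_compl.mem_nhds h] with w hw
      exact image_eq_zero_of_notMem_tsupport hw
    have hz' : (fun y => θ z.1 y) =ᶠ[𝓝 z.2] fun _ => 0 := by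
      have hc : ContinuousAt (fun y => ((z.1, y) : ℝ × EuclideanSpace ℝ (Fin 3))) z.2 :=
        (Continuous.prodMk_right z.1).continuousAt
      exact hc.eventually (show ∀ᶠ w in 𝓝 ((z.1, z.2) : ℝ × EuclideanSpace ℝ (Fin 3)), uncurry θ w = 0 from hev)
    apply hz
    rw [gradient, hz'.fderiv_eq, fderiv_fun_const, Pi.zero_apply, map_zero]
  have hdivae : (fun z : ℝ × EuclideanSpace ℝ (Fin 3) => VectorCalculus.divergence (X z.1) z.2) =ᵐ[volume]
      fun z => ⟪W z.1 z.2 + V z.1 z.2, gradient (θ z.1) z.2⟫ := by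
    filter_upwards [hdivV] with z hz
    rw [hdiv z, hz, mul_zero, zero_add]
  have hdm : AEStronglyMeasurable (fun z : ℝ × EuclideanSpace ℝ (Fin 3) =>
      VectorCalculus.divergence (X z.1) z.2) (volume : Measure (ℝ × EuclideanSpace ℝ (Fin 3))) :=
    (((cW.aestronglyMeasurable.add hVm).inner cgθ.aestronglyMeasurable).congr hdivae.symm)
  have hbK : ∀ z ∈ K', ‖W z.1 z.2 + V z.1 z.2‖ ≤ |MW| + CV := fun z hz =>
    (norm_add_le _ _).trans (add_le_add ((hMW z hz).trans (le_abs_self _)) (hVb _ _))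
  have hCX : ∀ᵐ z : ℝ × EuclideanSpace ℝ (Fin 3), ‖X z.1 z.2‖ ≤ Cθ * (|MW| + CV) := ae_of_all _ fun z => by
    by_cases hz : z ∈ K'
    · simp only [hX, norm_smul]
      exact mul_le_mul (hCθ z.1 z.2) (hbK z hz) (norm_nonneg _) hCθ0
    · rw [hXK z.1 z.2 hz, norm_zero]; positivity
  have hCd : ∀ᵐ z : ℝ × EuclideanSpace ℝ (Fin 3), |VectorCalculus.divergence (X z.1) z.2| ≤ (|MW| + CV) * Cg := by
    filter_upwards [hdivV] with z hzV
    rw [hdiv z, hzV, mul_zero, zero_add]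
    by_cases hg0 : gradient (θ z.1) z.2 = 0
    · rw [hg0, inner_zero_right, abs_zero]; positivity
    · have hz := hgradK z hg0
      calc |⟪W z.1 z.2 + V z.1 z.2, gradient (θ z.1) z.2⟫|
          ≤ ‖W z.1 z.2 + V z.1 z.2‖ * ‖gradient (θ z.1) z.2‖ := abs_real_inner_le_norm _ _
        _ ≤ (|MW| + CV) * Cg := mul_le_mul (hbK z hz) (hCg z.1 z.2) (norm_nonneg _) (by positivity)
  -- the polarized identity for `X`
  have hP := hG.integral_inner_apply_field_polarized hU2 hG2 hψ hK' hXK hX1 hXm hdm hCX hCd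
  have hψ0 : ∀ z : ℝ × EuclideanSpace ℝ (Fin 3), z ∉ K → ψ z.1 z.2 = 0 ∧ fderiv ℝ (ψ z.1) z.2 = 0 := fun z hz =>
    ⟨(image_eq_zero_of_notMem_tsupport hz : uncurry ψ z = 0),
      IsSpaceTimeTestOn.fderiv_slice_eq_zero_of_notMem hz⟩
  have hXb : ∀ z ∈ K, X z.1 z.2 = W z.1 z.2 + V z.1 z.2 := fun z hz => by
    simp only [hX, hθ1 z (ball_subset_closedBall (hKR hz)), one_smul]
  have e1 : (∫ z : ℝ × EuclideanSpace ℝ (Fin 3), ⟪G z.1 z.2 (X z.1 z.2), ψ z.1 z.2⟫) =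
      ∫ z : ℝ × EuclideanSpace ℝ (Fin 3), ⟪G z.1 z.2 (W z.1 z.2 + V z.1 z.2), ψ z.1 z.2⟫ := by
    refine integral_congr_ae (ae_of_all _ fun z => ?_)
    dsimp only
    by_cases hz : z ∈ K
    · rw [hXb z hz]
    · simp only [(hψ0 z hz).1, inner_zero_right]
  have e2 : (∫ z : ℝ × EuclideanSpace ℝ (Fin 3), ⟪fderiv ℝ (ψ z.1) z.2 (X z.1 z.2), U z.1 z.2⟫) =
      ∫ z : ℝ × EuclideanSpace ℝ (Fin 3), ⟪fderiv ℝ (ψ z.1) z.2 (W z.1 z.2 + V z.1 z.2), U z.1 z.2⟫ := by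
    refine integral_congr_ae (ae_of_all _ fun z => ?_)
    dsimp only
    by_cases hz : z ∈ K
    · rw [hXb z hz]
    · rw [(hψ0 z hz).2]; rfl
  have e3 : (∫ z : ℝ × EuclideanSpace ℝ (Fin 3), ⟪U z.1 z.2, ψ z.1 z.2⟫ * VectorCalculus.divergence (X z.1) z.2) = 0 := by
    refine integral_eq_zero_of_ae ?_
    filter_upwards [hdivV] with z hzV
    simp only [Pi.zero_apply]
    by_cases hz : z ∈ K
    · rw [hdiv z, hzV, hθg z (hKR hz), inner_zero_right, mul_zero, add_zero, mul_zero]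
    · simp only [(hψ0 z hz).1, inner_zero_right, zero_mul]
  rw [e1, e2, e3, neg_zero] at hP
  exact hP

end Polarized

/-! ### Integrability helpers -/

section Helpers

/-- `⟪Γ X, ψ⟫` is integrable for an operator field `Γ ∈ L¹_loc`, `X` measurable and bounded on the
compact support `K` of the continuous `ψ`. [folklore] -/
theorem integrable_inner_opField_apply {Γ : ℝ × EuclideanSpace ℝ (Fin 3) → EuclideanSpace ℝ (Fin 3) →L[ℝ] EuclideanSpace ℝ (Fin 3)} {X ψ : ℝ × EuclideanSpace ℝ (Fin 3) → EuclideanSpace ℝ (Fin 3)}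
    (hΓ : LocallyIntegrable Γ volume) (hXm : AEStronglyMeasurable X volume)
    {K : Set (ℝ × EuclideanSpace ℝ (Fin 3))} (hK : IsCompact K) {CX : ℝ} (hCX : ∀ z ∈ K, ‖X z‖ ≤ CX)
    (hψc : Continuous ψ) (hψK : ∀ z, z ∉ K → ψ z = 0) :
    Integrable (fun z => ⟪Γ z (X z), ψ z⟫) volume := by
  have happ : Continuous (uncurry fun (L : EuclideanSpace ℝ (Fin 3) →L[ℝ] EuclideanSpace ℝ (Fin 3)) (v : EuclideanSpace ℝ (Fin 3)) => L v) :=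
    isBoundedBilinearMap_apply.continuous
  obtain ⟨Cψ, hCψ⟩ := hψc.bounded_above_of_compact_support (HasCompactSupport.intro hK hψK)
  have hsupp : support (fun z => ⟪Γ z (X z), ψ z⟫) ⊆ K := fun z hz => by
    by_contra h
    exact hz (show ⟪Γ z (X z), ψ z⟫ = 0 by rw [hψK z h, inner_zero_right])
  refine (integrableOn_iff_integrable_of_support_subset hsupp).1 ?_
  refine Integrable.mono' ((hΓ.integrableOn_isCompact hK).norm.mul_const (|CX| * Cψ))
    (((happ.comp_aestronglyMeasurable (hΓ.aestronglyMeasurable.prodMk hXm)).inner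
      hψc.aestronglyMeasurable).restrict) ?_
  filter_upwards [ae_restrict_mem hK.measurableSet] with z hz
  calc ‖⟪Γ z (X z), ψ z⟫‖ ≤ ‖Γ z (X z)‖ * ‖ψ z‖ := norm_inner_le_norm _ _
    _ ≤ (‖Γ z‖ * |CX|) * Cψ := mul_le_mul (((Γ z).le_opNorm _).trans
        (mul_le_mul_of_nonneg_left ((hCX z hz).trans (le_abs_self _)) (norm_nonneg _))) (hCψ z)
        (norm_nonneg _) (by positivity)
    _ = ‖Γ z‖ * (|CX| * Cψ) := by ring

/-- `⟪Γ X, ψ⟫` is integrable for a continuous operator field `Γ`, `X ∈ L¹_loc` and a continuous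
`ψ` supported in a compact set. [folklore] -/
theorem integrable_inner_opField_apply_of_locallyIntegrable {Γ : ℝ × EuclideanSpace ℝ (Fin 3) → EuclideanSpace ℝ (Fin 3) →L[ℝ] EuclideanSpace ℝ (Fin 3)}
    {X ψ : ℝ × EuclideanSpace ℝ (Fin 3) → EuclideanSpace ℝ (Fin 3)} (hΓ : Continuous Γ) (hX : LocallyIntegrable X volume)
    {K : Set (ℝ × EuclideanSpace ℝ (Fin 3))} (hK : IsCompact K) (hψc : Continuous ψ) (hψK : ∀ z, z ∉ K → ψ z = 0) :
    Integrable (fun z => ⟪Γ z (X z), ψ z⟫) volume := by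
  have happ : Continuous (uncurry fun (L : EuclideanSpace ℝ (Fin 3) →L[ℝ] EuclideanSpace ℝ (Fin 3)) (v : EuclideanSpace ℝ (Fin 3)) => L v) :=
    isBoundedBilinearMap_apply.continuous
  obtain ⟨Cψ, hCψ⟩ := hψc.bounded_above_of_compact_support (HasCompactSupport.intro hK hψK)
  obtain ⟨CΓ, hCΓ⟩ := hK.exists_bound_of_continuousOn hΓ.continuousOn
  have hsupp : support (fun z => ⟪Γ z (X z), ψ z⟫) ⊆ K := fun z hz => by
    by_contra h
    exact hz (show ⟪Γ z (X z), ψ z⟫ = 0 by rw [hψK z h, inner_zero_right])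
  refine (integrableOn_iff_integrable_of_support_subset hsupp).1 ?_
  refine Integrable.mono' ((hX.integrableOn_isCompact hK).norm.const_mul (|CΓ| * Cψ))
    (((happ.comp_aestronglyMeasurable (hΓ.aestronglyMeasurable.prodMk hX.aestronglyMeasurable)).inner
      hψc.aestronglyMeasurable).restrict) ?_
  filter_upwards [ae_restrict_mem hK.measurableSet] with z hz
  calc ‖⟪Γ z (X z), ψ z⟫‖ ≤ ‖Γ z (X z)‖ * ‖ψ z‖ := norm_inner_le_norm _ _
    _ ≤ (|CΓ| * ‖X z‖) * Cψ := mul_le_mul (((Γ z).le_opNorm _).trans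
        (mul_le_mul_of_nonneg_right ((hCΓ z hz).trans (le_abs_self _)) (norm_nonneg _))) (hCψ z)
        (norm_nonneg _) (by positivity)
    _ = |CΓ| * Cψ * ‖X z‖ := by ring

/-- `Γ X ∈ L¹_loc` for an operator field `Γ ∈ L¹_loc` and `X` measurable, bounded on compact sets.
[folklore] -/
theorem locallyIntegrable_opField_apply {Γ : ℝ × EuclideanSpace ℝ (Fin 3) → EuclideanSpace ℝ (Fin 3) →L[ℝ] EuclideanSpace ℝ (Fin 3)} {X : ℝ × EuclideanSpace ℝ (Fin 3) → EuclideanSpace ℝ (Fin 3)}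
    (hΓ : LocallyIntegrable Γ volume) (hXm : AEStronglyMeasurable X volume)
    (hXb : ∀ K : Set (ℝ × EuclideanSpace ℝ (Fin 3)), IsCompact K → ∃ C : ℝ, ∀ z ∈ K, ‖X z‖ ≤ C) :
    LocallyIntegrable (fun z => Γ z (X z)) volume := by
  have happ : Continuous (uncurry fun (L : EuclideanSpace ℝ (Fin 3) →L[ℝ] EuclideanSpace ℝ (Fin 3)) (v : EuclideanSpace ℝ (Fin 3)) => L v) :=
    isBoundedBilinearMap_apply.continuous
  refine locallyIntegrable_iff.2 fun K hK => ?_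
  obtain ⟨C, hC⟩ := hXb K hK
  refine Integrable.mono' ((hΓ.integrableOn_isCompact hK).norm.mul_const |C|)
    ((happ.comp_aestronglyMeasurable (hΓ.aestronglyMeasurable.prodMk hXm)).restrict) ?_
  filter_upwards [ae_restrict_mem hK.measurableSet] with z hz
  exact ((Γ z).le_opNorm _).trans (mul_le_mul_of_nonneg_left ((hC z hz).trans (le_abs_self _)) (norm_nonneg _))

/-- `Γ X ∈ L¹_loc` for a continuous operator field `Γ` and `X ∈ L¹_loc`. [folklore] -/
theorem locallyIntegrable_opField_apply_of_continuous {Γ : ℝ × EuclideanSpace ℝ (Fin 3) → EuclideanSpace ℝ (Fin 3) →L[ℝ] EuclideanSpace ℝ (Fin 3)} {X : ℝ × EuclideanSpace ℝ (Fin 3) → EuclideanSpace ℝ (Fin 3)}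
    (hΓ : Continuous Γ) (hX : LocallyIntegrable X volume) :
    LocallyIntegrable (fun z => Γ z (X z)) volume := by
  have happ : Continuous (uncurry fun (L : EuclideanSpace ℝ (Fin 3) →L[ℝ] EuclideanSpace ℝ (Fin 3)) (v : EuclideanSpace ℝ (Fin 3)) => L v) :=
    isBoundedBilinearMap_apply.continuous
  refine locallyIntegrable_iff.2 fun K hK => ?_
  obtain ⟨C, hC⟩ := hK.exists_bound_of_continuousOn hΓ.continuousOn
  refine Integrable.mono' ((hX.integrableOn_isCompact hK).norm.const_mul |C|)
    ((happ.comp_aestronglyMeasurable (hΓ.aestronglyMeasurable.prodMk hX.aestronglyMeasurable)).restrict) ?_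
  filter_upwards [ae_restrict_mem hK.measurableSet] with z hz
  calc ‖Γ z (X z)‖ ≤ ‖Γ z‖ * ‖X z‖ := (Γ z).le_opNorm _
    _ ≤ |C| * ‖X z‖ := mul_le_mul_of_nonneg_right ((hC z hz).trans (le_abs_self _)) (norm_nonneg _)

/-- A bounded measurable field has a locally integrable square. [folklore] -/
theorem locallyIntegrable_sq_of_bound {X : ℝ × EuclideanSpace ℝ (Fin 3) → EuclideanSpace ℝ (Fin 3)} (hXm : AEStronglyMeasurable X volume)
    {C : ℝ} (hC : ∀ z, ‖X z‖ ≤ C) : LocallyIntegrable (fun z => ‖X z‖ ^ 2) volume := by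
  refine locallyIntegrable_iff.2 fun K hK => ?_
  refine Integrable.mono' (integrableOn_const (C := C ^ 2) (hs := hK.measure_lt_top.ne))
    (hXm.norm.pow 2).restrict (ae_of_all _ fun z => ?_)
  rw [Real.norm_eq_abs, abs_of_nonneg (sq_nonneg _)]
  exact pow_le_pow_left₀ (norm_nonneg _) (hC z) 2

end Helpers

/-! ### The very weak form from the line weak form -/

section VeryWeak

variable {U W V : ℝ → EuclideanSpace ℝ (Fin 3) → EuclideanSpace ℝ (Fin 3)}
  {G : ℝ → EuclideanSpace ℝ (Fin 3) → EuclideanSpace ℝ (Fin 3) →L[ℝ] EuclideanSpace ℝ (Fin 3)}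

set_option maxHeartbeats 1600000 in
/-- **From the line weak form to the very weak form** ([BT1], proof of Thm 2.4: the periodic
weak formulation, written on the line (`PeriodicLerayTestPeriodization.weakForm_line_of_period`),
implies the very weak form of the mollified perturbed Leray system used by
`distributional_of_veryWeak_slices`). If `U` (with an `L²_loc` weak spatial gradient `G` on
`ℝ × ℝ³`, a.e. slice weakly divergence free) satisfies, for every space–time test field `ψ` with
divergence-free slices,
`∫ ds (∫ (⟪U, ∂ₛψ⟫ − G : Dψ + ⟪U + G y − G b − DW U − DW W, ψ⟫) − ⟨LW(s), ψ(s)⟩) = 0`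
(`b = W + V`), then
`∫∫ (⟪u, ∂ₛψ + Δψ⟫ − ⟪u, 2ψ + (y·∇)ψ⟫ + ⟪U, (b·∇)ψ⟫ + ⟪W, (u·∇)ψ⟫) = 0`, `u = U + W`:
every lower-order term is moved onto `ψ` (`integral_inner_laplacian_eq_neg_sum`,
`integral_inner_apply_self_polarized`, `integral_inner_apply_drift_polarized`,
`integral_inner_convect_profile_eq_neg`, `integral_lerayPairing_eq_neg`). [cite: BradshawTsai2017AHP, proof of Thm 2.4 (weak formulation of the mollified system)] -/
theorem veryWeak_of_lineWeakForm
    (hG : HasWeakSpatialGradientOn (⊤ : Opens (ℝ × EuclideanSpace ℝ (Fin 3))) U G)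
    (hU2 : LocallyIntegrable (fun z : ℝ × EuclideanSpace ℝ (Fin 3) => ‖U z.1 z.2‖ ^ 2) volume)
    (hG2 : LocallyIntegrable (fun z : ℝ × EuclideanSpace ℝ (Fin 3) => frobeniusNormSq (G z.1 z.2)) volume)
    (hW : ContDiff ℝ 1 (uncurry W)) (hdivW : ∀ s, VectorCalculus.IsDivFree (W s))
    (hV1 : ∀ s, ContDiff ℝ 1 (V s)) (hVm : AEStronglyMeasurable (uncurry V) volume) {CV : ℝ}
    (hVb : ∀ s y, ‖V s y‖ ≤ CV)
    (hdivV : ∀ᵐ z : ℝ × EuclideanSpace ℝ (Fin 3), VectorCalculus.divergence (V z.1) z.2 = 0)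
    (hUdiv : ∀ᵐ s : ℝ, IsWeaklyDivFree (U s))
    (hline : ∀ ψ : ℝ → EuclideanSpace ℝ (Fin 3) → EuclideanSpace ℝ (Fin 3), IsSpaceTimeTestOn (⊤ : Opens (ℝ × EuclideanSpace ℝ (Fin 3))) ψ →
      (∀ t, VectorCalculus.IsDivFree (ψ t)) →
      ∫ s, ((∫ y, (⟪U s y, timeDeriv ψ s y⟫ - frobeniusInner (G s y) (fderiv ℝ (ψ s) y) +
          ⟪U s y + G s y y - G s y (W s y + V s y) - fderiv ℝ (W s) y (U s y) -
            fderiv ℝ (W s) y (W s y), ψ s y⟫)) - lerayPairing W s (ψ s)) = 0)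
    {ψ : ℝ → EuclideanSpace ℝ (Fin 3) → EuclideanSpace ℝ (Fin 3)} (hψ : IsSpaceTimeTestOn (⊤ : Opens (ℝ × EuclideanSpace ℝ (Fin 3))) ψ)
    (hψdiv : ∀ t, VectorCalculus.IsDivFree (ψ t)) :
    ∫ z : ℝ × EuclideanSpace ℝ (Fin 3), (⟪U z.1 z.2 + W z.1 z.2, timeDeriv ψ z.1 z.2⟫ + ⟪U z.1 z.2 + W z.1 z.2, Δ (ψ z.1) z.2⟫ - ⟪U z.1 z.2 + W z.1 z.2, (2 : ℝ) • ψ z.1 z.2 + fderiv ℝ (ψ z.1) z.2 z.2⟫ + ⟪U z.1 z.2, convect (W z.1 + V z.1) (ψ z.1) z.2⟫ + ⟪W z.1 z.2, convect (U z.1 + W z.1) (ψ z.1) z.2⟫) = 0 := by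
  have happ : Continuous (uncurry fun (L : EuclideanSpace ℝ (Fin 3) →L[ℝ] EuclideanSpace ℝ (Fin 3)) (v : EuclideanSpace ℝ (Fin 3)) => L v) :=
    isBoundedBilinearMap_apply.continuous
  -- ## the test field
  set K : Set (ℝ × EuclideanSpace ℝ (Fin 3)) := tsupport (uncurry ψ) with hK_def
  have hK : IsCompact K := hψ.hasCompactSupport
  have hKQ : K ⊆ ((⊤ : Opens (ℝ × EuclideanSpace ℝ (Fin 3))) : Set (ℝ × EuclideanSpace ℝ (Fin 3))) := fun _ _ => trivial
  have hψ0 : ∀ z : ℝ × EuclideanSpace ℝ (Fin 3), z ∉ K → ψ z.1 z.2 = 0 ∧ fderiv ℝ (ψ z.1) z.2 = 0 ∧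
      timeDeriv ψ z.1 z.2 = 0 ∧ Δ (ψ z.1) z.2 = 0 := fun z hz =>
    ⟨(image_eq_zero_of_notMem_tsupport hz : uncurry ψ z = 0),
      IsSpaceTimeTestOn.fderiv_slice_eq_zero_of_notMem hz,
      IsSpaceTimeTestOn.timeDeriv_eq_zero_of_notMem hz, laplacian_slice_eq_zero_of_notMem_tsupport hz⟩
  have cψ : Continuous fun z : ℝ × EuclideanSpace ℝ (Fin 3) => ψ z.1 z.2 := hψ.contDiff.continuous
  have cDψ : Continuous fun z : ℝ × EuclideanSpace ℝ (Fin 3) => fderiv ℝ (ψ z.1) z.2 := hψ.fderiv_top.contDiff.continuous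
  have cψt : Continuous fun z : ℝ × EuclideanSpace ℝ (Fin 3) => timeDeriv ψ z.1 z.2 := hψ.timeDeriv_top.contDiff.continuous
  have cψL : Continuous fun z : ℝ × EuclideanSpace ℝ (Fin 3) => Δ (ψ z.1) z.2 := hψ.laplacian_top.contDiff.continuous
  obtain ⟨R, hR⟩ := hK.isBounded.exists_norm_le
  -- ## the profile, the drift
  have cW : Continuous fun z : ℝ × EuclideanSpace ℝ (Fin 3) => W z.1 z.2 := hW.continuous
  have cDW : Continuous fun z : ℝ × EuclideanSpace ℝ (Fin 3) => fderiv ℝ (W z.1) z.2 := continuous_fderiv_slice hW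
  obtain ⟨MW, hMW⟩ := hK.exists_bound_of_continuousOn cW.continuousOn
  have hWli : LocallyIntegrable (uncurry W) volume := hW.continuous.locallyIntegrable
  have hW2 : LocallyIntegrable (fun z : ℝ × EuclideanSpace ℝ (Fin 3) => ‖W z.1 z.2‖ ^ 2) volume := (cW.norm.pow 2).locallyIntegrable
  have hDW2 : LocallyIntegrable (fun z : ℝ × EuclideanSpace ℝ (Fin 3) => frobeniusNormSq (fderiv ℝ (W z.1) z.2)) volume :=
    (LerayHopfProofs.continuous_frobeniusNormSq.comp cDW).locallyIntegrable
  have hWG : HasWeakSpatialGradientOn (⊤ : Opens (ℝ × EuclideanSpace ℝ (Fin 3))) W fun t x => fderiv ℝ (W t) x :=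
    hasWeakSpatialGradientOn_of_contDiffOn isOpen_univ (fun _ _ => by simp)
      (by rw [univ_prod_univ]; exact hW.contDiffOn)
  have hWdivae : ∀ᵐ s : ℝ, IsWeaklyDivFree (W s) := ae_of_all _ fun s =>
    VectorCalculus.IsDivFree.isWeaklyDivFree_holds (hdivW s) (hW.comp (contDiff_prodMk_right s))
  have hbm : AEStronglyMeasurable (fun z : ℝ × EuclideanSpace ℝ (Fin 3) => W z.1 z.2 + V z.1 z.2) volume :=
    cW.aestronglyMeasurable.add hVm
  have hVli : LocallyIntegrable (uncurry V) volume := by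
    refine locallyIntegrable_iff.2 fun K' hK' => ?_
    exact Integrable.mono' (integrableOn_const (C := CV) (hs := hK'.measure_lt_top.ne)) hVm.restrict
      (ae_of_all _ fun z => hVb z.1 z.2)
  have hbli : LocallyIntegrable (fun z : ℝ × EuclideanSpace ℝ (Fin 3) => W z.1 z.2 + V z.1 z.2) volume := hWli.add hVli
  have hb2 : LocallyIntegrable (fun z : ℝ × EuclideanSpace ℝ (Fin 3) => ‖W z.1 z.2 + V z.1 z.2‖ ^ 2) volume :=
    locallyIntegrable_norm_add_sq cW.aestronglyMeasurable hVm hW2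
      (locallyIntegrable_sq_of_bound hVm fun z => hVb z.1 z.2)
  have hbK : ∀ z ∈ K, ‖W z.1 z.2 + V z.1 z.2‖ ≤ |MW| + CV := fun z hz =>
    (norm_add_le _ _).trans (add_le_add ((hMW z hz).trans (le_abs_self _)) (hVb _ _))
  -- ## the field `U` and its gradient
  have hUli : LocallyIntegrable (uncurry U) volume := by
    have h := hG.locallyIntegrableOn
    rw [TopologicalSpace.Opens.coe_top] at h
    exact locallyIntegrableOn_univ.1 h
  have hGli : LocallyIntegrable (uncurry G) volume := by
    have h := hG.locallyIntegrableOn_grad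
    rw [TopologicalSpace.Opens.coe_top] at h
    exact locallyIntegrableOn_univ.1 h
  have hUm : AEStronglyMeasurable (uncurry U) volume := hUli.aestronglyMeasurable
  have hUWli : LocallyIntegrable (uncurry fun s y => U s y + W s y) volume := hUli.add hWli
  have hUW2 : LocallyIntegrable (fun z : ℝ × EuclideanSpace ℝ (Fin 3) => ‖U z.1 z.2 + W z.1 z.2‖ ^ 2) volume :=
    locallyIntegrable_norm_add_sq hUm cW.aestronglyMeasurable hU2 hW2
  have hdivST : ∀ θ : ℝ → EuclideanSpace ℝ (Fin 3) → ℝ, IsSpaceTimeTestOn (⊤ : Opens (ℝ × EuclideanSpace ℝ (Fin 3))) θ →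
      ∫ z : ℝ × EuclideanSpace ℝ (Fin 3), ⟪U z.1 z.2 + W z.1 z.2, gradient (θ z.1) z.2⟫ = 0 := fun θ hθ =>
    integral_inner_add_gradient_eq_zero_of_ae hUli hWli hUdiv hWdivae hθ
  -- the lower-order field `F` of the line weak form is locally integrable
  have hFli : LocallyIntegrable (uncurry fun s y => U s y + G s y y - G s y (W s y + V s y) -
      fderiv ℝ (W s) y (U s y) - fderiv ℝ (W s) y (W s y)) volume := by
    have h1 : LocallyIntegrable (fun z : ℝ × EuclideanSpace ℝ (Fin 3) => G z.1 z.2 z.2) volume :=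
      locallyIntegrable_opField_apply hGli continuous_snd.aestronglyMeasurable fun K' hK' => by
        obtain ⟨R', hR'⟩ := hK'.isBounded.exists_norm_le
        exact ⟨R', fun z hz => (norm_snd_le z).trans (hR' z hz)⟩
    have h2 : LocallyIntegrable (fun z : ℝ × EuclideanSpace ℝ (Fin 3) => G z.1 z.2 (W z.1 z.2 + V z.1 z.2)) volume :=
      locallyIntegrable_opField_apply hGli hbm fun K' hK' => by
        obtain ⟨M', hM'⟩ := hK'.exists_bound_of_continuousOn cW.continuousOn
        exact ⟨M' + CV, fun z hz => (norm_add_le _ _).trans (add_le_add (hM' z hz) (hVb _ _))⟩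
    have h3 : LocallyIntegrable (fun z : ℝ × EuclideanSpace ℝ (Fin 3) => fderiv ℝ (W z.1) z.2 (U z.1 z.2)) volume :=
      locallyIntegrable_opField_apply_of_continuous cDW hUli
    have h4 : LocallyIntegrable (fun z : ℝ × EuclideanSpace ℝ (Fin 3) => fderiv ℝ (W z.1) z.2 (W z.1 z.2)) volume :=
      (happ.comp (cDW.prodMk cW)).locallyIntegrable
    exact (((hUli.add h1).sub h2).sub h3).sub h4
  obtain ⟨i1, i2, i3⟩ := integrable_pairings hUli hGli hFli hψ
  obtain ⟨-, -, i4⟩ := integrable_lerayPairing_integrand hW hψ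
  -- ## (0) the line weak form as an identity between space–time integrals
  have e0 : (∫ z : ℝ × EuclideanSpace ℝ (Fin 3), ⟪U z.1 z.2, timeDeriv ψ z.1 z.2⟫) - (∫ z : ℝ × EuclideanSpace ℝ (Fin 3), frobeniusInner (G z.1 z.2) (fderiv ℝ (ψ z.1) z.2)) + (∫ z : ℝ × EuclideanSpace ℝ (Fin 3), ⟪(U z.1 z.2 + G z.1 z.2 z.2 - G z.1 z.2 (W z.1 z.2 + V z.1 z.2) - fderiv ℝ (W z.1) z.2 (U z.1 z.2) - fderiv ℝ (W z.1) z.2 (W z.1 z.2)), ψ z.1 z.2⟫) - ∫ s, lerayPairing W s (ψ s) = 0 := by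
    have h := hline ψ hψ hψdiv
    have hI : Integrable (fun z : ℝ × EuclideanSpace ℝ (Fin 3) => ⟪U z.1 z.2, timeDeriv ψ z.1 z.2⟫ - frobeniusInner (G z.1 z.2) (fderiv ℝ (ψ z.1) z.2) + ⟪(U z.1 z.2 + G z.1 z.2 z.2 - G z.1 z.2 (W z.1 z.2 + V z.1 z.2) - fderiv ℝ (W z.1) z.2 (U z.1 z.2) - fderiv ℝ (W z.1) z.2 (W z.1 z.2)), ψ z.1 z.2⟫) volume := (i1.sub i2).add i3
    have hI' : Integrable (fun z : ℝ × EuclideanSpace ℝ (Fin 3) => ⟪U z.1 z.2, timeDeriv ψ z.1 z.2⟫ - frobeniusInner (G z.1 z.2) (fderiv ℝ (ψ z.1) z.2) + ⟪(U z.1 z.2 + G z.1 z.2 z.2 - G z.1 z.2 (W z.1 z.2 + V z.1 z.2) - fderiv ℝ (W z.1) z.2 (U z.1 z.2) - fderiv ℝ (W z.1) z.2 (W z.1 z.2)), ψ z.1 z.2⟫)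
        ((volume : Measure ℝ).prod (volume : Measure (EuclideanSpace ℝ (Fin 3)))) := by
      rw [← Measure.volume_eq_prod]; exact hI
    have hc : Integrable (fun s => ∫ y, (⟪U s y, timeDeriv ψ s y⟫ - frobeniusInner (G s y) (fderiv ℝ (ψ s) y) +
        ⟪U s y + G s y y - G s y (W s y + V s y) - fderiv ℝ (W s) y (U s y) -
          fderiv ℝ (W s) y (W s y), ψ s y⟫)) (volume : Measure ℝ) := hI'.integral_prod_left
    have hF : (∫ z : ℝ × EuclideanSpace ℝ (Fin 3), ⟪U z.1 z.2, timeDeriv ψ z.1 z.2⟫ - frobeniusInner (G z.1 z.2) (fderiv ℝ (ψ z.1) z.2) + ⟪(U z.1 z.2 + G z.1 z.2 z.2 - G z.1 z.2 (W z.1 z.2 + V z.1 z.2) - fderiv ℝ (W z.1) z.2 (U z.1 z.2) - fderiv ℝ (W z.1) z.2 (W z.1 z.2)), ψ z.1 z.2⟫) =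
        ∫ s, ∫ y, (⟪U s y, timeDeriv ψ s y⟫ - frobeniusInner (G s y) (fderiv ℝ (ψ s) y) +
          ⟪U s y + G s y y - G s y (W s y + V s y) - fderiv ℝ (W s) y (U s y) -
            fderiv ℝ (W s) y (W s y), ψ s y⟫) := by
      rw [Measure.volume_eq_prod, integral_prod _ hI']
    have h1 := integral_sub hc i4
    have h3 : (∫ z : ℝ × EuclideanSpace ℝ (Fin 3), (⟪U z.1 z.2, timeDeriv ψ z.1 z.2⟫ -
        frobeniusInner (G z.1 z.2) (fderiv ℝ (ψ z.1) z.2) +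
        ⟪(U z.1 z.2 + G z.1 z.2 z.2 - G z.1 z.2 (W z.1 z.2 + V z.1 z.2) - fderiv ℝ (W z.1) z.2 (U z.1 z.2) -
          fderiv ℝ (W z.1) z.2 (W z.1 z.2)), ψ z.1 z.2⟫)) =
        (∫ z : ℝ × EuclideanSpace ℝ (Fin 3), ⟪U z.1 z.2, timeDeriv ψ z.1 z.2⟫) -
          (∫ z : ℝ × EuclideanSpace ℝ (Fin 3), frobeniusInner (G z.1 z.2) (fderiv ℝ (ψ z.1) z.2)) +
          ∫ z : ℝ × EuclideanSpace ℝ (Fin 3), ⟪(U z.1 z.2 + G z.1 z.2 z.2 - G z.1 z.2 (W z.1 z.2 + V z.1 z.2) -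
            fderiv ℝ (W z.1) z.2 (U z.1 z.2) - fderiv ℝ (W z.1) z.2 (W z.1 z.2)), ψ z.1 z.2⟫ := by
      have s12 : Integrable (fun z : ℝ × EuclideanSpace ℝ (Fin 3) => ⟪U z.1 z.2, timeDeriv ψ z.1 z.2⟫ -
          frobeniusInner (G z.1 z.2) (fderiv ℝ (ψ z.1) z.2)) volume := i1.sub i2
      rw [integral_add s12 i3, integral_sub i1 i2]
    linarith [h, h1, hF, h3]
  -- ## (1) the viscous terms
  have e1 : (∫ z : ℝ × EuclideanSpace ℝ (Fin 3), frobeniusInner (G z.1 z.2) (fderiv ℝ (ψ z.1) z.2)) = -∫ z : ℝ × EuclideanSpace ℝ (Fin 3), ⟪U z.1 z.2, Δ (ψ z.1) z.2⟫ := by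
    rw [hG.integral_inner_laplacian_eq_neg_sum hψ, neg_neg]
    rfl
  have e7 : (∫ z : ℝ × EuclideanSpace ℝ (Fin 3), frobeniusInner (fderiv ℝ (W z.1) z.2) (fderiv ℝ (ψ z.1) z.2)) = -∫ z : ℝ × EuclideanSpace ℝ (Fin 3), ⟪W z.1 z.2, Δ (ψ z.1) z.2⟫ := by
    rw [hWG.integral_inner_laplacian_eq_neg_sum hψ, neg_neg]
    rfl
  -- ## (2) integrability of the atoms
  have hEU : Integrable (fun z : ℝ × EuclideanSpace ℝ (Fin 3) => ⟪U z.1 z.2, ψ z.1 z.2⟫) volume :=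
    integrable_inner_of_locallyIntegrableOn (hUli.locallyIntegrableOn _) (w := fun z => ψ z.1 z.2) cψ hK hKQ
      fun z hz => (hψ0 z hz).1
  have hEW : Integrable (fun z : ℝ × EuclideanSpace ℝ (Fin 3) => ⟪W z.1 z.2, ψ z.1 z.2⟫) volume :=
    integrable_inner_of_locallyIntegrableOn (hWli.locallyIntegrableOn _) (w := fun z => ψ z.1 z.2) cψ hK hKQ
      fun z hz => (hψ0 z hz).1
  have hB1 : Integrable (fun z : ℝ × EuclideanSpace ℝ (Fin 3) => ⟪W z.1 z.2, timeDeriv ψ z.1 z.2⟫) volume :=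
    integrable_inner_of_locallyIntegrableOn (hWli.locallyIntegrableOn _) (w := fun z => timeDeriv ψ z.1 z.2) cψt
      hK hKQ fun z hz => (hψ0 z hz).2.2.1
  have hLU : Integrable (fun z : ℝ × EuclideanSpace ℝ (Fin 3) => ⟪U z.1 z.2, Δ (ψ z.1) z.2⟫) volume :=
    integrable_inner_of_locallyIntegrableOn (hUli.locallyIntegrableOn _) (w := fun z => Δ (ψ z.1) z.2) cψL
      hK hKQ fun z hz => (hψ0 z hz).2.2.2
  have hLW : Integrable (fun z : ℝ × EuclideanSpace ℝ (Fin 3) => ⟪W z.1 z.2, Δ (ψ z.1) z.2⟫) volume :=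
    integrable_inner_of_locallyIntegrableOn (hWli.locallyIntegrableOn _) (w := fun z => Δ (ψ z.1) z.2) cψL
      hK hKQ fun z hz => (hψ0 z hz).2.2.2
  have cDy : Continuous fun z : ℝ × EuclideanSpace ℝ (Fin 3) => fderiv ℝ (ψ z.1) z.2 z.2 := happ.comp (cDψ.prodMk continuous_snd)
  have hSyU : Integrable (fun z : ℝ × EuclideanSpace ℝ (Fin 3) => ⟪U z.1 z.2, fderiv ℝ (ψ z.1) z.2 z.2⟫) volume :=
    integrable_inner_of_locallyIntegrableOn (hUli.locallyIntegrableOn _) (w := fun z => fderiv ℝ (ψ z.1) z.2 z.2) cDy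
      hK hKQ fun z hz => by rw [(hψ0 z hz).2.1]; rfl
  have hSyW : Integrable (fun z : ℝ × EuclideanSpace ℝ (Fin 3) => ⟪W z.1 z.2, fderiv ℝ (ψ z.1) z.2 z.2⟫) volume :=
    integrable_inner_of_locallyIntegrableOn (hWli.locallyIntegrableOn _) (w := fun z => fderiv ℝ (ψ z.1) z.2 z.2) cDy
      hK hKQ fun z hz => by rw [(hψ0 z hz).2.1]; rfl
  have hSbU : Integrable (fun z : ℝ × EuclideanSpace ℝ (Fin 3) => ⟪U z.1 z.2, fderiv ℝ (ψ z.1) z.2 (W z.1 z.2 + V z.1 z.2)⟫) volume :=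
    integrable_inner_clm_apply (F₁ := fun z => U z.1 z.2) (F₂ := fun z => W z.1 z.2 + V z.1 z.2) hUli hbli hU2 hb2
      (D := fun z => fderiv ℝ (ψ z.1) z.2) cDψ hK fun z hz => (hψ0 z hz).2.1
  have hWDu : Integrable (fun z : ℝ × EuclideanSpace ℝ (Fin 3) => ⟪W z.1 z.2, fderiv ℝ (ψ z.1) z.2 (U z.1 z.2 + W z.1 z.2)⟫) volume :=
    integrable_inner_clm_apply (F₁ := fun z => W z.1 z.2) (F₂ := fun z => U z.1 z.2 + W z.1 z.2) hWli hUWli hW2 hUW2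
      (D := fun z => fderiv ℝ (ψ z.1) z.2) cDψ hK fun z hz => (hψ0 z hz).2.1
  have hGyU : Integrable (fun z : ℝ × EuclideanSpace ℝ (Fin 3) => ⟪G z.1 z.2 z.2, ψ z.1 z.2⟫) volume :=
    integrable_inner_opField_apply (Γ := fun z => G z.1 z.2) (X := fun z => z.2) hGli
      continuous_snd.aestronglyMeasurable hK (fun z hz => (norm_snd_le z).trans (hR z hz)) cψ
      fun z hz => (hψ0 z hz).1
  have hGbU : Integrable (fun z : ℝ × EuclideanSpace ℝ (Fin 3) => ⟪G z.1 z.2 (W z.1 z.2 + V z.1 z.2), ψ z.1 z.2⟫) volume :=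
    integrable_inner_opField_apply (Γ := fun z => G z.1 z.2) (X := fun z => W z.1 z.2 + V z.1 z.2) hGli hbm hK
      hbK cψ fun z hz => (hψ0 z hz).1
  have hDWu : Integrable (fun z : ℝ × EuclideanSpace ℝ (Fin 3) => ⟪fderiv ℝ (W z.1) z.2 (U z.1 z.2 + W z.1 z.2), ψ z.1 z.2⟫) volume :=
    integrable_inner_opField_apply_of_locallyIntegrable (Γ := fun z => fderiv ℝ (W z.1) z.2) (X := fun z => U z.1 z.2 + W z.1 z.2)
      cDW hUWli hK cψ fun z hz => (hψ0 z hz).1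
  have hGyW : Integrable (fun z : ℝ × EuclideanSpace ℝ (Fin 3) => ⟪fderiv ℝ (W z.1) z.2 z.2, ψ z.1 z.2⟫) volume :=
    integrable_inner_opField_apply_of_locallyIntegrable (Γ := fun z => fderiv ℝ (W z.1) z.2) (X := fun z => z.2)
      cDW continuous_snd.locallyIntegrable hK cψ fun z hz => (hψ0 z hz).1
  have hB2 : Integrable (fun z : ℝ × EuclideanSpace ℝ (Fin 3) => frobeniusInner (fderiv ℝ (W z.1) z.2) (fderiv ℝ (ψ z.1) z.2)) volume := by
    have hc : Continuous fun z : ℝ × EuclideanSpace ℝ (Fin 3) => frobeniusInner (fderiv ℝ (W z.1) z.2) (fderiv ℝ (ψ z.1) z.2) := by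
      simp only [frobeniusInner]
      exact continuous_finsetSum _ fun i _ =>
        (happ.comp (cDW.prodMk continuous_const)).inner (happ.comp (cDψ.prodMk continuous_const))
    exact hc.integrable_of_hasCompactSupport (HasCompactSupport.intro hK fun z hz => by
      rw [(hψ0 z hz).2.1, frobeniusInner_zero_right])
  -- ## (3) the identities between the atoms
  have e2 : (∫ z : ℝ × EuclideanSpace ℝ (Fin 3), ⟪(U z.1 z.2 + G z.1 z.2 z.2 - G z.1 z.2 (W z.1 z.2 + V z.1 z.2) - fderiv ℝ (W z.1) z.2 (U z.1 z.2) - fderiv ℝ (W z.1) z.2 (W z.1 z.2)), ψ z.1 z.2⟫) = (∫ z : ℝ × EuclideanSpace ℝ (Fin 3), ⟪U z.1 z.2, ψ z.1 z.2⟫) + (∫ z : ℝ × EuclideanSpace ℝ (Fin 3), ⟪G z.1 z.2 z.2, ψ z.1 z.2⟫) - (∫ z : ℝ × EuclideanSpace ℝ (Fin 3), ⟪G z.1 z.2 (W z.1 z.2 + V z.1 z.2), ψ z.1 z.2⟫) - ∫ z : ℝ × EuclideanSpace ℝ (Fin 3), ⟪fderiv ℝ (W z.1) z.2 (U z.1 z.2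 + W z.1 z.2), ψ z.1 z.2⟫ := by
    have s1 : Integrable (fun z : ℝ × EuclideanSpace ℝ (Fin 3) => ⟪U z.1 z.2, ψ z.1 z.2⟫ + ⟪G z.1 z.2 z.2, ψ z.1 z.2⟫) volume := hEU.add hGyU
    have s2 : Integrable (fun z : ℝ × EuclideanSpace ℝ (Fin 3) => ⟪U z.1 z.2, ψ z.1 z.2⟫ + ⟪G z.1 z.2 z.2, ψ z.1 z.2⟫ - ⟪G z.1 z.2 (W z.1 z.2 + V z.1 z.2), ψ z.1 z.2⟫) volume := s1.sub hGbU
    rw [← integral_add hEU hGyU, ← integral_sub s1 hGbU, ← integral_sub s2 hDWu]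
    refine integral_congr_ae (ae_of_all _ fun z => ?_)
    dsimp only
    simp only [inner_sub_left, inner_add_left, map_add]
    ring
  have e3 := integral_inner_apply_self_polarized hG hU2 hG2 hψ
  have e3' : (∫ z : ℝ × EuclideanSpace ℝ (Fin 3), ⟪fderiv ℝ (ψ z.1) z.2 z.2, U z.1 z.2⟫) = ∫ z : ℝ × EuclideanSpace ℝ (Fin 3), ⟪U z.1 z.2, fderiv ℝ (ψ z.1) z.2 z.2⟫ :=
    integral_congr_ae (ae_of_all _ fun z => real_inner_comm _ _)
  have e4 := integral_inner_apply_drift_polarized W V hG hU2 hG2 hW hdivW hV1 hVm hVb hdivV hψ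
  have e4' : (∫ z : ℝ × EuclideanSpace ℝ (Fin 3), ⟪fderiv ℝ (ψ z.1) z.2 (W z.1 z.2 + V z.1 z.2), U z.1 z.2⟫) = ∫ z : ℝ × EuclideanSpace ℝ (Fin 3), ⟪U z.1 z.2, fderiv ℝ (ψ z.1) z.2 (W z.1 z.2 + V z.1 z.2)⟫ :=
    integral_congr_ae (ae_of_all _ fun z => real_inner_comm _ _)
  have e5 := integral_inner_convect_profile_eq_neg (u := fun s y => U s y + W s y) hUWli hdivST hW hψ
  have e6 : ∫ s, lerayPairing W s (ψ s) = -((∫ z : ℝ × EuclideanSpace ℝ (Fin 3), ⟪W z.1 z.2, timeDeriv ψ z.1 z.2⟫) - (∫ z : ℝ × EuclideanSpace ℝ (Fin 3), frobeniusInner (fderiv ℝ (W z.1) z.2) (fderiv ℝ (ψ z.1) z.2)) + ((∫ z : ℝ × EuclideanSpace ℝ (Fin 3), ⟪W z.1 z.2, ψ z.1 z.2⟫) + ∫ z : ℝ × EuclideanSpace ℝ (Fin 3), ⟪fderiv ℝ (W z.1) z.2 z.2, ψ z.1 z.2⟫)) := by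
    rw [integral_lerayPairing_eq_neg hW hψ]
    have s1 : Integrable (fun z : ℝ × EuclideanSpace ℝ (Fin 3) => ⟪W z.1 z.2, timeDeriv ψ z.1 z.2⟫ - frobeniusInner (fderiv ℝ (W z.1) z.2) (fderiv ℝ (ψ z.1) z.2)) volume := hB1.sub hB2
    have s2 : Integrable (fun z : ℝ × EuclideanSpace ℝ (Fin 3) => ⟪W z.1 z.2, ψ z.1 z.2⟫ + ⟪fderiv ℝ (W z.1) z.2 z.2, ψ z.1 z.2⟫) volume := hEW.add hGyW
    rw [← integral_add hEW hGyW, ← integral_sub hB1 hB2, ← integral_add s1 s2]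
    congr 1
    refine integral_congr_ae (ae_of_all _ fun z => ?_)
    dsimp only
    rw [inner_add_left]
  have e9 := integral_inner_apply_self_polarized hWG hW2 hDW2 hψ
  have e9' : (∫ z : ℝ × EuclideanSpace ℝ (Fin 3), ⟪fderiv ℝ (ψ z.1) z.2 z.2, W z.1 z.2⟫) = ∫ z : ℝ × EuclideanSpace ℝ (Fin 3), ⟪W z.1 z.2, fderiv ℝ (ψ z.1) z.2 z.2⟫ :=
    integral_congr_ae (ae_of_all _ fun z => real_inner_comm _ _)
  -- ## (4) the target, split into atoms
  have eT : (∫ z : ℝ × EuclideanSpace ℝ (Fin 3), (⟪U z.1 z.2 + W z.1 z.2, timeDeriv ψ z.1 z.2⟫ + ⟪U z.1 z.2 + W z.1 z.2, Δ (ψ z.1) z.2⟫ - ⟪U z.1 z.2 + W z.1 z.2, (2 : ℝ) • ψ z.1 z.2 + fderiv ℝ (ψ z.1) z.2 z.2⟫ + ⟪U z.1 z.2, convect (W z.1 + V z.1) (ψ z.1) z.2⟫ + ⟪W z.1 z.2, convect (U z.1 + W z.1) (ψ z.1) z.2⟫)) =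
      (∫ z : ℝ × EuclideanSpace ℝ (Fin 3), ⟪U z.1 z.2, timeDeriv ψ z.1 z.2⟫) + (∫ z : ℝ × EuclideanSpace ℝ (Fin 3), ⟪W z.1 z.2, timeDeriv ψ z.1 z.2⟫) + (∫ z : ℝ × EuclideanSpace ℝ (Fin 3), ⟪U z.1 z.2, Δ (ψ z.1) z.2⟫) + (∫ z : ℝ × EuclideanSpace ℝ (Fin 3), ⟪W z.1 z.2, Δ (ψ z.1) z.2⟫) - 2 * (∫ z : ℝ × EuclideanSpace ℝ (Fin 3), ⟪U z.1 z.2, ψ z.1 z.2⟫) - 2 * (∫ z : ℝ × EuclideanSpace ℝ (Fin 3), ⟪W z.1 z.2, ψ z.1 z.2⟫) -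
        (∫ z : ℝ × EuclideanSpace ℝ (Fin 3), ⟪U z.1 z.2, fderiv ℝ (ψ z.1) z.2 z.2⟫) - (∫ z : ℝ × EuclideanSpace ℝ (Fin 3), ⟪W z.1 z.2, fderiv ℝ (ψ z.1) z.2 z.2⟫) + (∫ z : ℝ × EuclideanSpace ℝ (Fin 3), ⟪U z.1 z.2, fderiv ℝ (ψ z.1) z.2 (W z.1 z.2 + V z.1 z.2)⟫) + ∫ z : ℝ × EuclideanSpace ℝ (Fin 3), ⟪W z.1 z.2, fderiv ℝ (ψ z.1) z.2 (U z.1 z.2 + W z.1 z.2)⟫ := by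
    have t2 : Integrable (fun z : ℝ × EuclideanSpace ℝ (Fin 3) => ⟪U z.1 z.2, timeDeriv ψ z.1 z.2⟫ + ⟪W z.1 z.2, timeDeriv ψ z.1 z.2⟫) volume := i1.add hB1
    have t3 : Integrable (fun z : ℝ × EuclideanSpace ℝ (Fin 3) => ⟪U z.1 z.2, timeDeriv ψ z.1 z.2⟫ + ⟪W z.1 z.2, timeDeriv ψ z.1 z.2⟫ + ⟪U z.1 z.2, Δ (ψ z.1) z.2⟫) volume := t2.add hLU
    have t4 : Integrable (fun z : ℝ × EuclideanSpace ℝ (Fin 3) => ⟪U z.1 z.2, timeDeriv ψ z.1 z.2⟫ + ⟪W z.1 z.2, timeDeriv ψ z.1 z.2⟫ + ⟪U z.1 z.2, Δ (ψ z.1) z.2⟫ + ⟪W z.1 z.2, Δ (ψ z.1) z.2⟫) volume := t3.add hLW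
    have t5 : Integrable (fun z : ℝ × EuclideanSpace ℝ (Fin 3) => ⟪U z.1 z.2, timeDeriv ψ z.1 z.2⟫ + ⟪W z.1 z.2, timeDeriv ψ z.1 z.2⟫ + ⟪U z.1 z.2, Δ (ψ z.1) z.2⟫ + ⟪W z.1 z.2, Δ (ψ z.1) z.2⟫ - 2 * ⟪U z.1 z.2, ψ z.1 z.2⟫) volume := t4.sub (hEU.const_mul 2)
    have t6 : Integrable (fun z : ℝ × EuclideanSpace ℝ (Fin 3) => ⟪U z.1 z.2, timeDeriv ψ z.1 z.2⟫ + ⟪W z.1 z.2, timeDeriv ψ z.1 z.2⟫ + ⟪U z.1 z.2, Δ (ψ z.1) z.2⟫ + ⟪W z.1 z.2, Δ (ψ z.1) z.2⟫ - 2 * ⟪U z.1 z.2, ψ z.1 z.2⟫ - 2 * ⟪W z.1 z.2, ψ z.1 z.2⟫) volume :=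
      t5.sub (hEW.const_mul 2)
    have t7 : Integrable (fun z : ℝ × EuclideanSpace ℝ (Fin 3) => ⟪U z.1 z.2, timeDeriv ψ z.1 z.2⟫ + ⟪W z.1 z.2, timeDeriv ψ z.1 z.2⟫ + ⟪U z.1 z.2, Δ (ψ z.1) z.2⟫ + ⟪W z.1 z.2, Δ (ψ z.1) z.2⟫ - 2 * ⟪U z.1 z.2, ψ z.1 z.2⟫ - 2 * ⟪W z.1 z.2, ψ z.1 z.2⟫ - ⟪U z.1 z.2, fderiv ℝ (ψ z.1) z.2 z.2⟫) volume :=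
      t6.sub hSyU
    have t8 : Integrable (fun z : ℝ × EuclideanSpace ℝ (Fin 3) => ⟪U z.1 z.2, timeDeriv ψ z.1 z.2⟫ + ⟪W z.1 z.2, timeDeriv ψ z.1 z.2⟫ + ⟪U z.1 z.2, Δ (ψ z.1) z.2⟫ + ⟪W z.1 z.2, Δ (ψ z.1) z.2⟫ - 2 * ⟪U z.1 z.2, ψ z.1 z.2⟫ - 2 * ⟪W z.1 z.2, ψ z.1 z.2⟫ - ⟪U z.1 z.2, fderiv ℝ (ψ z.1) z.2 z.2⟫ -
        ⟪W z.1 z.2, fderiv ℝ (ψ z.1) z.2 z.2⟫) volume := t7.sub hSyW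
    have t9 : Integrable (fun z : ℝ × EuclideanSpace ℝ (Fin 3) => ⟪U z.1 z.2, timeDeriv ψ z.1 z.2⟫ + ⟪W z.1 z.2, timeDeriv ψ z.1 z.2⟫ + ⟪U z.1 z.2, Δ (ψ z.1) z.2⟫ + ⟪W z.1 z.2, Δ (ψ z.1) z.2⟫ - 2 * ⟪U z.1 z.2, ψ z.1 z.2⟫ - 2 * ⟪W z.1 z.2, ψ z.1 z.2⟫ - ⟪U z.1 z.2, fderiv ℝ (ψ z.1) z.2 z.2⟫ -
        ⟪W z.1 z.2, fderiv ℝ (ψ z.1) z.2 z.2⟫ + ⟪U z.1 z.2, fderiv ℝ (ψ z.1) z.2 (W z.1 z.2 + V z.1 z.2)⟫) volume := t8.add hSbU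
    have hEU2 : Integrable (fun z : ℝ × EuclideanSpace ℝ (Fin 3) => 2 * ⟪U z.1 z.2, ψ z.1 z.2⟫) volume := hEU.const_mul 2
    have hEW2 : Integrable (fun z : ℝ × EuclideanSpace ℝ (Fin 3) => 2 * ⟪W z.1 z.2, ψ z.1 z.2⟫) volume := hEW.const_mul 2
    rw [← integral_const_mul, ← integral_const_mul, ← integral_add i1 hB1, ← integral_add t2 hLU,
      ← integral_add t3 hLW, ← integral_sub t4 hEU2, ← integral_sub t5 hEW2, ← integral_sub t6 hSyU,
      ← integral_sub t7 hSyW, ← integral_add t8 hSbU, ← integral_add t9 hWDu]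
    refine integral_congr_ae (ae_of_all _ fun z => ?_)
    dsimp only
    simp only [convect, Pi.add_apply, inner_add_left, inner_add_right, inner_smul_right, map_add]
    ring
  -- ## (5) conclude
  rw [eT]
  rw [e3'] at e3
  rw [e4'] at e4
  rw [e9'] at e9
  linarith [e0, e1, e2, e3, e4, e5, e6, e7, e9]

end VeryWeak

/-! ### The Stokes form from the distributional formulation -/

section StokesForm

variable {U W V : ℝ → EuclideanSpace ℝ (Fin 3) → EuclideanSpace ℝ (Fin 3)}
  {G : ℝ → EuclideanSpace ℝ (Fin 3) → EuclideanSpace ℝ (Fin 3) →L[ℝ] EuclideanSpace ℝ (Fin 3)} {p : ℝ → EuclideanSpace ℝ (Fin 3) → ℝ}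

/-- `|G + L|²_F` is locally integrable for `|G|²_F ∈ L¹_loc` and `L` continuous. [folklore] -/
theorem locallyIntegrable_frobeniusNormSq_add {Γ L : ℝ × EuclideanSpace ℝ (Fin 3) → EuclideanSpace ℝ (Fin 3) →L[ℝ] EuclideanSpace ℝ (Fin 3)}
    (hΓm : AEStronglyMeasurable Γ volume) (hΓ2 : LocallyIntegrable (fun z => frobeniusNormSq (Γ z)) volume)
    (hL : Continuous L) : LocallyIntegrable (fun z => frobeniusNormSq (Γ z + L z)) volume := by
  refine locallyIntegrable_iff.2 fun K hK => ?_
  have h1 := hΓ2.integrableOn_isCompact hK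
  obtain ⟨MF, hMF⟩ := hK.exists_bound_of_continuousOn
    (f := fun z : ℝ × EuclideanSpace ℝ (Fin 3) => frobeniusNormSq (L z)) ((LerayHopfProofs.continuous_frobeniusNormSq.comp hL).continuousOn)
  have hb : IntegrableOn (fun _ : ℝ × EuclideanSpace ℝ (Fin 3) => (2 : ℝ) * MF) K volume := integrableOn_const (hs := hK.measure_lt_top.ne)
  have hbd : IntegrableOn (fun z : ℝ × EuclideanSpace ℝ (Fin 3) => 2 * frobeniusNormSq (Γ z) + 2 * MF) K volume := (h1.const_mul 2).add hb
  refine Integrable.mono' hbd (LerayHopfProofs.continuous_frobeniusNormSq.comp_aestronglyMeasurable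
    (hΓm.restrict.add hL.aestronglyMeasurable.restrict)) ?_
  filter_upwards [ae_restrict_mem hK.measurableSet] with z hz
  rw [Real.norm_eq_abs, abs_of_nonneg (frobeniusNormSq_nonneg _)]
  have h := frobeniusNormSq_add_le (Γ z) (L z)
  have h2 := hMF z hz
  rw [Real.norm_eq_abs, abs_of_nonneg (frobeniusNormSq_nonneg _)] at h2
  linarith

/-- `p w` is integrable for `p ∈ L¹_loc` and a continuous `w` supported in a compact set.
[folklore] -/
theorem integrable_mul_of_locallyIntegrable_of_compact {q w : ℝ × EuclideanSpace ℝ (Fin 3) → ℝ} (hq : LocallyIntegrable q volume)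
    (hw : Continuous w) {K : Set (ℝ × EuclideanSpace ℝ (Fin 3))} (hK : IsCompact K) (hwK : ∀ z, z ∉ K → w z = 0) :
    Integrable (fun z => q z * w z) volume := by
  obtain ⟨C, hC⟩ := hw.bounded_above_of_compact_support (HasCompactSupport.intro hK hwK)
  have hsupp : support (fun z => q z * w z) ⊆ K := fun z hz => by
    by_contra h
    exact hz (show q z * w z = 0 by rw [hwK z h, mul_zero])
  refine (integrableOn_iff_integrable_of_support_subset hsupp).1 ?_
  exact (hq.integrableOn_isCompact hK).mul_bdd hw.aestronglyMeasurable.restrict (ae_of_all _ hC)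

set_option maxHeartbeats 1600000 in
/-- **From the distributional formulation to the Stokes form** ([BT1], proof of Thm 2.4, to
apply the local energy equality of the Stokes system): if `(u, p)`, `u = U + W`, satisfies the
distributional clause of `IsMollifiedPeriodicWeakSolution` (with drift `b = W + V`),
`∫∫ ⟪u, ∂ₛψ + Δψ⟫ − ⟪u, 2ψ + (y·∇)ψ⟫ + ⟪U, (b·∇)ψ⟫ + ⟪W, (u·∇)ψ⟫ + p div ψ = 0`, `U` has an
`L²_loc` weak spatial gradient `G` with a.e. weakly divergence-free slices and `p ∈ L¹_loc`, then
`(u, p)` is a distributional solution on `ℝ × ℝ³` of the Stokes system with force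
`f = u + (G + DW) y − G b − DW u` (the lower-order terms moved back onto the unknown by
`integral_inner_apply_self_polarized`, `integral_inner_apply_drift_polarized`,
`integral_inner_convect_profile_eq_neg`). [cite: BradshawTsai2017AHP, proof of Thm 2.4 (local energy equality of the approximants); Seregin2014, §4.6 (4.6.1)] -/
theorem stokesForm_of_distributional
    (hG : HasWeakSpatialGradientOn (⊤ : Opens (ℝ × EuclideanSpace ℝ (Fin 3))) U G)
    (hU2 : LocallyIntegrable (fun z : ℝ × EuclideanSpace ℝ (Fin 3) => ‖U z.1 z.2‖ ^ 2) volume)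
    (hG2 : LocallyIntegrable (fun z : ℝ × EuclideanSpace ℝ (Fin 3) => frobeniusNormSq (G z.1 z.2)) volume)
    (hW : ContDiff ℝ 1 (uncurry W)) (hdivW : ∀ s, VectorCalculus.IsDivFree (W s))
    (hV1 : ∀ s, ContDiff ℝ 1 (V s)) (hVm : AEStronglyMeasurable (uncurry V) volume) {CV : ℝ}
    (hVb : ∀ s y, ‖V s y‖ ≤ CV)
    (hdivV : ∀ᵐ z : ℝ × EuclideanSpace ℝ (Fin 3), VectorCalculus.divergence (V z.1) z.2 = 0)
    (hUdiv : ∀ᵐ s : ℝ, IsWeaklyDivFree (U s))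
    (hp : LocallyIntegrable (uncurry p) volume)
    (hdist : ∀ ψ : ℝ → EuclideanSpace ℝ (Fin 3) → EuclideanSpace ℝ (Fin 3), IsSpaceTimeTestOn (⊤ : Opens (ℝ × EuclideanSpace ℝ (Fin 3))) ψ →
      ∫ z : ℝ × EuclideanSpace ℝ (Fin 3), (⟪U z.1 z.2 + W z.1 z.2, timeDeriv ψ z.1 z.2⟫ + ⟪U z.1 z.2 + W z.1 z.2, Δ (ψ z.1) z.2⟫ - ⟪U z.1 z.2 + W z.1 z.2, (2 : ℝ) • ψ z.1 z.2 + fderiv ℝ (ψ z.1) z.2 z.2⟫ + ⟪U z.1 z.2, convect (W z.1 + V z.1) (ψ z.1) z.2⟫ + ⟪W z.1 z.2, convect (U z.1 + W z.1) (ψ z.1) z.2⟫ + p z.1 z.2 * VectorCalculus.divergence (ψ z.1) z.2) = 0) :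
    IsDistributionalStokesSolutionOn (⊤ : Opens (ℝ × EuclideanSpace ℝ (Fin 3)))
      (fun s y => (U s y + W s y) + (G s y + fderiv ℝ (W s) y) y - G s y (W s y + V s y) -
        fderiv ℝ (W s) y (U s y + W s y))
      (fun s y => U s y + W s y) p := by
  have happ : Continuous (uncurry fun (L : EuclideanSpace ℝ (Fin 3) →L[ℝ] EuclideanSpace ℝ (Fin 3)) (v : EuclideanSpace ℝ (Fin 3)) => L v) :=
    isBoundedBilinearMap_apply.continuous
  -- ## the profile, the drift, the field
  have cW : Continuous fun z : ℝ × EuclideanSpace ℝ (Fin 3) => W z.1 z.2 := hW.continuous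
  have cDW : Continuous fun z : ℝ × EuclideanSpace ℝ (Fin 3) => fderiv ℝ (W z.1) z.2 := continuous_fderiv_slice hW
  have hWli : LocallyIntegrable (uncurry W) volume := hW.continuous.locallyIntegrable
  have hW2 : LocallyIntegrable (fun z : ℝ × EuclideanSpace ℝ (Fin 3) => ‖W z.1 z.2‖ ^ 2) volume := (cW.norm.pow 2).locallyIntegrable
  have hWG : HasWeakSpatialGradientOn (⊤ : Opens (ℝ × EuclideanSpace ℝ (Fin 3))) W fun t x => fderiv ℝ (W t) x :=
    hasWeakSpatialGradientOn_of_contDiffOn isOpen_univ (fun _ _ => by simp)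
      (by rw [univ_prod_univ]; exact hW.contDiffOn)
  have hWdivae : ∀ᵐ s : ℝ, IsWeaklyDivFree (W s) := ae_of_all _ fun s =>
    VectorCalculus.IsDivFree.isWeaklyDivFree_holds (hdivW s) (hW.comp (contDiff_prodMk_right s))
  have hbm : AEStronglyMeasurable (fun z : ℝ × EuclideanSpace ℝ (Fin 3) => W z.1 z.2 + V z.1 z.2) volume :=
    cW.aestronglyMeasurable.add hVm
  have hVli : LocallyIntegrable (uncurry V) volume := by
    refine locallyIntegrable_iff.2 fun K' hK' => ?_
    exact Integrable.mono' (integrableOn_const (C := CV) (hs := hK'.measure_lt_top.ne)) hVm.restrict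
      (ae_of_all _ fun z => hVb z.1 z.2)
  have hbli : LocallyIntegrable (fun z : ℝ × EuclideanSpace ℝ (Fin 3) => W z.1 z.2 + V z.1 z.2) volume := hWli.add hVli
  have hb2 : LocallyIntegrable (fun z : ℝ × EuclideanSpace ℝ (Fin 3) => ‖W z.1 z.2 + V z.1 z.2‖ ^ 2) volume :=
    locallyIntegrable_norm_add_sq cW.aestronglyMeasurable hVm hW2
      (locallyIntegrable_sq_of_bound hVm fun z => hVb z.1 z.2)
  have hUli : LocallyIntegrable (uncurry U) volume := by
    have h := hG.locallyIntegrableOn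
    rw [TopologicalSpace.Opens.coe_top] at h
    exact locallyIntegrableOn_univ.1 h
  have hGli : LocallyIntegrable (uncurry G) volume := by
    have h := hG.locallyIntegrableOn_grad
    rw [TopologicalSpace.Opens.coe_top] at h
    exact locallyIntegrableOn_univ.1 h
  have hUm : AEStronglyMeasurable (uncurry U) volume := hUli.aestronglyMeasurable
  have hGm : AEStronglyMeasurable (uncurry G) volume := hGli.aestronglyMeasurable
  have hUWli : LocallyIntegrable (uncurry fun s y => U s y + W s y) volume := hUli.add hWli
  have hUW2 : LocallyIntegrable (fun z : ℝ × EuclideanSpace ℝ (Fin 3) => ‖U z.1 z.2 + W z.1 z.2‖ ^ 2) volume :=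
    locallyIntegrable_norm_add_sq hUm cW.aestronglyMeasurable hU2 hW2
  have hsumG : HasWeakSpatialGradientOn (⊤ : Opens (ℝ × EuclideanSpace ℝ (Fin 3))) (fun t x => U t x + W t x)
      fun t x => G t x + fderiv ℝ (W t) x := hG.add hWG
  have hGu2 : LocallyIntegrable (fun z : ℝ × EuclideanSpace ℝ (Fin 3) => frobeniusNormSq (G z.1 z.2 + fderiv ℝ (W z.1) z.2)) volume :=
    locallyIntegrable_frobeniusNormSq_add (Γ := fun z => G z.1 z.2) hGm hG2 cDW
  have hGuli : LocallyIntegrable (fun z : ℝ × EuclideanSpace ℝ (Fin 3) => G z.1 z.2 + fderiv ℝ (W z.1) z.2) volume :=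
    hGli.add cDW.locallyIntegrable
  have hdivST : ∀ θ : ℝ → EuclideanSpace ℝ (Fin 3) → ℝ, IsSpaceTimeTestOn (⊤ : Opens (ℝ × EuclideanSpace ℝ (Fin 3))) θ →
      ∫ z : ℝ × EuclideanSpace ℝ (Fin 3), ⟪U z.1 z.2 + W z.1 z.2, gradient (θ z.1) z.2⟫ = 0 := fun θ hθ =>
    integral_inner_add_gradient_eq_zero_of_ae hUli hWli hUdiv hWdivae hθ
  -- the force is locally integrable
  have hforce : LocallyIntegrable (uncurry fun s y => (U s y + W s y) + (G s y + fderiv ℝ (W s) y) y -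
      G s y (W s y + V s y) - fderiv ℝ (W s) y (U s y + W s y)) volume := by
    have h1 : LocallyIntegrable (fun z : ℝ × EuclideanSpace ℝ (Fin 3) => (G z.1 z.2 + fderiv ℝ (W z.1) z.2) z.2) volume :=
      locallyIntegrable_opField_apply (Γ := fun z => G z.1 z.2 + fderiv ℝ (W z.1) z.2) hGuli
        continuous_snd.aestronglyMeasurable fun K' hK' => by
        obtain ⟨R', hR'⟩ := hK'.isBounded.exists_norm_le
        exact ⟨R', fun z hz => (norm_snd_le z).trans (hR' z hz)⟩
    have h2 : LocallyIntegrable (fun z : ℝ × EuclideanSpace ℝ (Fin 3) => G z.1 z.2 (W z.1 z.2 + V z.1 z.2)) volume :=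
      locallyIntegrable_opField_apply hGli hbm fun K' hK' => by
        obtain ⟨M', hM'⟩ := hK'.exists_bound_of_continuousOn cW.continuousOn
        exact ⟨M' + CV, fun z hz => (norm_add_le _ _).trans (add_le_add (hM' z hz) (hVb _ _))⟩
    have h3 : LocallyIntegrable (fun z : ℝ × EuclideanSpace ℝ (Fin 3) => fderiv ℝ (W z.1) z.2 (U z.1 z.2 + W z.1 z.2)) volume :=
      locallyIntegrable_opField_apply_of_continuous cDW hUWli
    exact ((hUWli.add h1).sub h2).sub h3
  refine ⟨hUWli.locallyIntegrableOn _, hp.locallyIntegrableOn _, hforce.locallyIntegrableOn _,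
    fun θ hθ => ?_, fun ψ hψ => ?_⟩
  · rw [TopologicalSpace.Opens.coe_top, Measure.restrict_univ]
    exact hdivST θ hθ
  rw [TopologicalSpace.Opens.coe_top, Measure.restrict_univ]
  -- ## the test field
  set K : Set (ℝ × EuclideanSpace ℝ (Fin 3)) := tsupport (uncurry ψ) with hK_def
  have hK : IsCompact K := hψ.hasCompactSupport
  have hKQ : K ⊆ ((⊤ : Opens (ℝ × EuclideanSpace ℝ (Fin 3))) : Set (ℝ × EuclideanSpace ℝ (Fin 3))) := fun _ _ => trivial
  have hψ0 : ∀ z : ℝ × EuclideanSpace ℝ (Fin 3), z ∉ K → ψ z.1 z.2 = 0 ∧ fderiv ℝ (ψ z.1) z.2 = 0 ∧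
      timeDeriv ψ z.1 z.2 = 0 ∧ Δ (ψ z.1) z.2 = 0 := fun z hz =>
    ⟨(image_eq_zero_of_notMem_tsupport hz : uncurry ψ z = 0),
      IsSpaceTimeTestOn.fderiv_slice_eq_zero_of_notMem hz,
      IsSpaceTimeTestOn.timeDeriv_eq_zero_of_notMem hz, laplacian_slice_eq_zero_of_notMem_tsupport hz⟩
  have hdiv0 : ∀ z : ℝ × EuclideanSpace ℝ (Fin 3), z ∉ K → VectorCalculus.divergence (ψ z.1) z.2 = 0 := fun z hz => by
    have ho : IsOpen (tsupport (uncurry ψ))ᶜ := (isClosed_tsupport _).isOpen_compl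
    have hev : (fun y => ψ z.1 y) =ᶠ[𝓝 z.2] fun _ => 0 := by
      have hc : ContinuousAt (fun y => ((z.1, y) : ℝ × EuclideanSpace ℝ (Fin 3))) z.2 := (Continuous.prodMk_right z.1).continuousAt
      have h2 : ∀ᶠ w in 𝓝 ((z.1, z.2) : ℝ × EuclideanSpace ℝ (Fin 3)), uncurry ψ w = 0 := by
        filter_upwards [ho.mem_nhds hz] with w hw
        exact image_eq_zero_of_notMem_tsupport hw
      exact hc.eventually h2
    rw [VectorCalculus.divergence, show ψ z.1 = fun y => ψ z.1 y from rfl, hev.fderiv_eq, fderiv_fun_const]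
    simp
  have cψ : Continuous fun z : ℝ × EuclideanSpace ℝ (Fin 3) => ψ z.1 z.2 := hψ.contDiff.continuous
  have cDψ : Continuous fun z : ℝ × EuclideanSpace ℝ (Fin 3) => fderiv ℝ (ψ z.1) z.2 := hψ.fderiv_top.contDiff.continuous
  have cψt : Continuous fun z : ℝ × EuclideanSpace ℝ (Fin 3) => timeDeriv ψ z.1 z.2 := hψ.timeDeriv_top.contDiff.continuous
  have cψL : Continuous fun z : ℝ × EuclideanSpace ℝ (Fin 3) => Δ (ψ z.1) z.2 := hψ.laplacian_top.contDiff.continuous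
  have cdiv : Continuous fun z : ℝ × EuclideanSpace ℝ (Fin 3) => VectorCalculus.divergence (ψ z.1) z.2 := by
    have e : (fun z : ℝ × EuclideanSpace ℝ (Fin 3) => VectorCalculus.divergence (ψ z.1) z.2) =
        fun z => ∑ i, ⟪stdOrthonormalBasis ℝ (EuclideanSpace ℝ (Fin 3)) i,
          fderiv ℝ (ψ z.1) z.2 (stdOrthonormalBasis ℝ (EuclideanSpace ℝ (Fin 3)) i)⟫ :=
      funext fun z => divergence_eq_sum_inner_fderiv _ _ _
    rw [e]
    exact continuous_finsetSum _ fun i _ => continuous_const.inner (happ.comp (cDψ.prodMk continuous_const))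
  obtain ⟨R, hR⟩ := hK.isBounded.exists_norm_le
  obtain ⟨MW, hMW⟩ := hK.exists_bound_of_continuousOn cW.continuousOn
  have hbK : ∀ z ∈ K, ‖W z.1 z.2 + V z.1 z.2‖ ≤ |MW| + CV := fun z hz =>
    (norm_add_le _ _).trans (add_le_add ((hMW z hz).trans (le_abs_self _)) (hVb _ _))
  -- ## integrability of the atoms
  have hA : Integrable (fun z : ℝ × EuclideanSpace ℝ (Fin 3) => ⟪U z.1 z.2 + W z.1 z.2, timeDeriv ψ z.1 z.2⟫) volume :=
    integrable_inner_of_locallyIntegrableOn (hUWli.locallyIntegrableOn _) (w := fun z => timeDeriv ψ z.1 z.2) cψt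
      hK hKQ fun z hz => (hψ0 z hz).2.2.1
  have hL : Integrable (fun z : ℝ × EuclideanSpace ℝ (Fin 3) => ⟪U z.1 z.2 + W z.1 z.2, Δ (ψ z.1) z.2⟫) volume :=
    integrable_inner_of_locallyIntegrableOn (hUWli.locallyIntegrableOn _) (w := fun z => Δ (ψ z.1) z.2) cψL
      hK hKQ fun z hz => (hψ0 z hz).2.2.2
  have hE : Integrable (fun z : ℝ × EuclideanSpace ℝ (Fin 3) => ⟪U z.1 z.2 + W z.1 z.2, ψ z.1 z.2⟫) volume :=
    integrable_inner_of_locallyIntegrableOn (hUWli.locallyIntegrableOn _) (w := fun z => ψ z.1 z.2) cψ hK hKQ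
      fun z hz => (hψ0 z hz).1
  have cDy : Continuous fun z : ℝ × EuclideanSpace ℝ (Fin 3) => fderiv ℝ (ψ z.1) z.2 z.2 := happ.comp (cDψ.prodMk continuous_snd)
  have hSy : Integrable (fun z : ℝ × EuclideanSpace ℝ (Fin 3) => ⟪U z.1 z.2 + W z.1 z.2, fderiv ℝ (ψ z.1) z.2 z.2⟫) volume :=
    integrable_inner_of_locallyIntegrableOn (hUWli.locallyIntegrableOn _) (w := fun z => fderiv ℝ (ψ z.1) z.2 z.2) cDy
      hK hKQ fun z hz => by rw [(hψ0 z hz).2.1]; rfl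
  have hSb : Integrable (fun z : ℝ × EuclideanSpace ℝ (Fin 3) => ⟪U z.1 z.2, fderiv ℝ (ψ z.1) z.2 (W z.1 z.2 + V z.1 z.2)⟫) volume :=
    integrable_inner_clm_apply (F₁ := fun z => U z.1 z.2) (F₂ := fun z => W z.1 z.2 + V z.1 z.2) hUli hbli hU2 hb2
      (D := fun z => fderiv ℝ (ψ z.1) z.2) cDψ hK fun z hz => (hψ0 z hz).2.1
  have hWD : Integrable (fun z : ℝ × EuclideanSpace ℝ (Fin 3) => ⟪W z.1 z.2, fderiv ℝ (ψ z.1) z.2 (U z.1 z.2 + W z.1 z.2)⟫) volume :=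
    integrable_inner_clm_apply (F₁ := fun z => W z.1 z.2) (F₂ := fun z => U z.1 z.2 + W z.1 z.2) hWli hUWli hW2 hUW2
      (D := fun z => fderiv ℝ (ψ z.1) z.2) cDψ hK fun z hz => (hψ0 z hz).2.1
  have hP : Integrable (fun z : ℝ × EuclideanSpace ℝ (Fin 3) => p z.1 z.2 * VectorCalculus.divergence (ψ z.1) z.2) volume :=
    integrable_mul_of_locallyIntegrable_of_compact (q := fun z => p z.1 z.2) hp cdiv hK hdiv0
  have hF : Integrable (fun z : ℝ × EuclideanSpace ℝ (Fin 3) => ⟪(U z.1 z.2 + W z.1 z.2) + (G z.1 z.2 + fderiv ℝ (W z.1) z.2) z.2 - G z.1 z.2 (W z.1 z.2 + V z.1 z.2) - fderiv ℝ (W z.1) z.2 (U z.1 z.2 + W z.1 z.2), ψ z.1 z.2⟫) volume :=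
    integrable_inner_of_locallyIntegrableOn (hforce.locallyIntegrableOn _) (w := fun z => ψ z.1 z.2) cψ hK hKQ
      fun z hz => (hψ0 z hz).1
  have hGy : Integrable (fun z : ℝ × EuclideanSpace ℝ (Fin 3) => ⟪(G z.1 z.2 + fderiv ℝ (W z.1) z.2) z.2, ψ z.1 z.2⟫) volume :=
    integrable_inner_opField_apply (Γ := fun z => G z.1 z.2 + fderiv ℝ (W z.1) z.2) (X := fun z => z.2) hGuli
      continuous_snd.aestronglyMeasurable hK (fun z hz => (norm_snd_le z).trans (hR z hz)) cψ
      fun z hz => (hψ0 z hz).1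
  have hGb : Integrable (fun z : ℝ × EuclideanSpace ℝ (Fin 3) => ⟪G z.1 z.2 (W z.1 z.2 + V z.1 z.2), ψ z.1 z.2⟫) volume :=
    integrable_inner_opField_apply (Γ := fun z => G z.1 z.2) (X := fun z => W z.1 z.2 + V z.1 z.2) hGli hbm hK
      hbK cψ fun z hz => (hψ0 z hz).1
  have hDWu : Integrable (fun z : ℝ × EuclideanSpace ℝ (Fin 3) => ⟪fderiv ℝ (W z.1) z.2 (U z.1 z.2 + W z.1 z.2), ψ z.1 z.2⟫) volume :=
    integrable_inner_opField_apply_of_locallyIntegrable (Γ := fun z => fderiv ℝ (W z.1) z.2) (X := fun z => U z.1 z.2 + W z.1 z.2)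
      cDW hUWli hK cψ fun z hz => (hψ0 z hz).1
  -- ## the identities
  have eF : (∫ z : ℝ × EuclideanSpace ℝ (Fin 3), ⟪(U z.1 z.2 + W z.1 z.2) + (G z.1 z.2 + fderiv ℝ (W z.1) z.2) z.2 - G z.1 z.2 (W z.1 z.2 + V z.1 z.2) - fderiv ℝ (W z.1) z.2 (U z.1 z.2 + W z.1 z.2), ψ z.1 z.2⟫) = (∫ z : ℝ × EuclideanSpace ℝ (Fin 3), ⟪U z.1 z.2 + W z.1 z.2, ψ z.1 z.2⟫) + (∫ z : ℝ × EuclideanSpace ℝ (Fin 3), ⟪(G z.1 z.2 + fderiv ℝ (W z.1) z.2) z.2, ψ z.1 z.2⟫) - (∫ z : ℝ × EuclideanSpace ℝ (Fin 3), ⟪G z.1 z.2 (W z.1 z.2 + V z.1 z.2), ψ z.1 z.2⟫) - ∫ z : ℝ × EuclideanSpace ℝ (Fin 3), ⟪fderiv ℝ (W z.1) z.2 (U z.1 z.2 + W z.1 z.2), ψ z.1 z.2⟫ := by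
    have s1 : Integrable (fun z : ℝ × EuclideanSpace ℝ (Fin 3) => ⟪U z.1 z.2 + W z.1 z.2, ψ z.1 z.2⟫ + ⟪(G z.1 z.2 + fderiv ℝ (W z.1) z.2) z.2, ψ z.1 z.2⟫) volume := hE.add hGy
    have s2 : Integrable (fun z : ℝ × EuclideanSpace ℝ (Fin 3) => ⟪U z.1 z.2 + W z.1 z.2, ψ z.1 z.2⟫ + ⟪(G z.1 z.2 + fderiv ℝ (W z.1) z.2) z.2, ψ z.1 z.2⟫ - ⟪G z.1 z.2 (W z.1 z.2 + V z.1 z.2), ψ z.1 z.2⟫) volume := s1.sub hGb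
    rw [← integral_add hE hGy, ← integral_sub s1 hGb, ← integral_sub s2 hDWu]
    refine integral_congr_ae (ae_of_all _ fun z => ?_)
    dsimp only
    simp only [inner_sub_left, inner_add_left]
  have e3 := integral_inner_apply_self_polarized hsumG hUW2 hGu2 hψ
  have e3' : (∫ z : ℝ × EuclideanSpace ℝ (Fin 3), ⟪fderiv ℝ (ψ z.1) z.2 z.2, U z.1 z.2 + W z.1 z.2⟫) = ∫ z : ℝ × EuclideanSpace ℝ (Fin 3), ⟪U z.1 z.2 + W z.1 z.2, fderiv ℝ (ψ z.1) z.2 z.2⟫ :=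
    integral_congr_ae (ae_of_all _ fun z => real_inner_comm _ _)
  have e4 := integral_inner_apply_drift_polarized W V hG hU2 hG2 hW hdivW hV1 hVm hVb hdivV hψ
  have e4' : (∫ z : ℝ × EuclideanSpace ℝ (Fin 3), ⟪fderiv ℝ (ψ z.1) z.2 (W z.1 z.2 + V z.1 z.2), U z.1 z.2⟫) = ∫ z : ℝ × EuclideanSpace ℝ (Fin 3), ⟪U z.1 z.2, fderiv ℝ (ψ z.1) z.2 (W z.1 z.2 + V z.1 z.2)⟫ :=
    integral_congr_ae (ae_of_all _ fun z => real_inner_comm _ _)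
  have e5 := integral_inner_convect_profile_eq_neg (u := fun s y => U s y + W s y) hUWli hdivST hW hψ
  have eD : (∫ z : ℝ × EuclideanSpace ℝ (Fin 3), (⟪U z.1 z.2 + W z.1 z.2, timeDeriv ψ z.1 z.2⟫ + ⟪U z.1 z.2 + W z.1 z.2, Δ (ψ z.1) z.2⟫ - ⟪U z.1 z.2 + W z.1 z.2, (2 : ℝ) • ψ z.1 z.2 + fderiv ℝ (ψ z.1) z.2 z.2⟫ + ⟪U z.1 z.2, convect (W z.1 + V z.1) (ψ z.1) z.2⟫ + ⟪W z.1 z.2, convect (U z.1 + W z.1) (ψ z.1) z.2⟫ + p z.1 z.2 * VectorCalculus.divergence (ψ z.1) z.2)) = (∫ z : ℝ × EuclideanSpace ℝ (Fin 3), ⟪U z.1 z.2 + W z.1 z.2, timeDeriv ψ z.1 z.2⟫) + (∫ z : ℝ × EuclideanSpace ℝ (Fin 3), ⟪U z.1 z.2 + W z.1 z.2, Δ (ψ z.1) z.2⟫) - 2 * (∫ z : ℝ × EuclideanSpace ℝ (Fin 3), ⟪U z.1 z.2 + W z.1 z.2, ψ z.1 z.2⟫) - (∫ z : ℝ × EuclideanSpace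 ℝ (Fin 3), ⟪U z.1 z.2 + W z.1 z.2, fderiv ℝ (ψ z.1) z.2 z.2⟫) + (∫ z : ℝ × EuclideanSpace ℝ (Fin 3), ⟪U z.1 z.2, fderiv ℝ (ψ z.1) z.2 (W z.1 z.2 + V z.1 z.2)⟫) + (∫ z : ℝ × EuclideanSpace ℝ (Fin 3), ⟪W z.1 z.2, fderiv ℝ (ψ z.1) z.2 (U z.1 z.2 + W z.1 z.2)⟫) + ∫ z : ℝ × EuclideanSpace ℝ (Fin 3), p z.1 z.2 * VectorCalculus.divergence (ψ z.1) z.2 := by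
    have t2 : Integrable (fun z : ℝ × EuclideanSpace ℝ (Fin 3) => ⟪U z.1 z.2 + W z.1 z.2, timeDeriv ψ z.1 z.2⟫ + ⟪U z.1 z.2 + W z.1 z.2, Δ (ψ z.1) z.2⟫) volume := hA.add hL
    have hE2 : Integrable (fun z : ℝ × EuclideanSpace ℝ (Fin 3) => 2 * ⟪U z.1 z.2 + W z.1 z.2, ψ z.1 z.2⟫) volume := hE.const_mul 2
    have t3 : Integrable (fun z : ℝ × EuclideanSpace ℝ (Fin 3) => ⟪U z.1 z.2 + W z.1 z.2, timeDeriv ψ z.1 z.2⟫ + ⟪U z.1 z.2 + W z.1 z.2, Δ (ψ z.1) z.2⟫ - 2 * ⟪U z.1 z.2 + W z.1 z.2, ψ z.1 z.2⟫) volume := t2.sub hE2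
    have t4 : Integrable (fun z : ℝ × EuclideanSpace ℝ (Fin 3) => ⟪U z.1 z.2 + W z.1 z.2, timeDeriv ψ z.1 z.2⟫ + ⟪U z.1 z.2 + W z.1 z.2, Δ (ψ z.1) z.2⟫ - 2 * ⟪U z.1 z.2 + W z.1 z.2, ψ z.1 z.2⟫ - ⟪U z.1 z.2 + W z.1 z.2, fderiv ℝ (ψ z.1) z.2 z.2⟫) volume := t3.sub hSy
    have t5 : Integrable (fun z : ℝ × EuclideanSpace ℝ (Fin 3) => ⟪U z.1 z.2 + W z.1 z.2, timeDeriv ψ z.1 z.2⟫ + ⟪U z.1 z.2 + W z.1 z.2, Δ (ψ z.1) z.2⟫ - 2 * ⟪U z.1 z.2 + W z.1 z.2, ψ z.1 z.2⟫ - ⟪U z.1 z.2 + W z.1 z.2, fderiv ℝ (ψ z.1) z.2 z.2⟫ + ⟪U z.1 z.2, fderiv ℝ (ψ z.1) z.2 (W z.1 z.2 + V z.1 z.2)⟫) volume := t4.add hSb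
    have t6 : Integrable (fun z : ℝ × EuclideanSpace ℝ (Fin 3) => ⟪U z.1 z.2 + W z.1 z.2, timeDeriv ψ z.1 z.2⟫ + ⟪U z.1 z.2 + W z.1 z.2, Δ (ψ z.1) z.2⟫ - 2 * ⟪U z.1 z.2 + W z.1 z.2, ψ z.1 z.2⟫ - ⟪U z.1 z.2 + W z.1 z.2, fderiv ℝ (ψ z.1) z.2 z.2⟫ + ⟪U z.1 z.2, fderiv ℝ (ψ z.1) z.2 (W z.1 z.2 + V z.1 z.2)⟫ + ⟪W z.1 z.2, fderiv ℝ (ψ z.1) z.2 (U z.1 z.2 + W z.1 z.2)⟫) volume :=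
      t5.add hWD
    rw [← integral_const_mul, ← integral_add hA hL, ← integral_sub t2 hE2, ← integral_sub t3 hSy,
      ← integral_add t4 hSb, ← integral_add t5 hWD, ← integral_add t6 hP]
    refine integral_congr_ae (ae_of_all _ fun z => ?_)
    dsimp only
    simp only [convect, Pi.add_apply, inner_add_right, inner_smul_right]
    ring
  have eM : (∫ z : ℝ × EuclideanSpace ℝ (Fin 3), (⟪U z.1 z.2 + W z.1 z.2, timeDeriv ψ z.1 z.2⟫ + ⟪U z.1 z.2 + W z.1 z.2, Δ (ψ z.1) z.2⟫ + p z.1 z.2 * VectorCalculus.divergence (ψ z.1) z.2 + ⟪(U z.1 z.2 + W z.1 z.2) + (G z.1 z.2 + fderiv ℝ (W z.1) z.2) z.2 - G z.1 z.2 (W z.1 z.2 + V z.1 z.2) - fderiv ℝ (W z.1) z.2 (U z.1 z.2 + W z.1 z.2), ψ z.1 z.2⟫)) = (∫ z : ℝ × EuclideanSpace ℝ (Fin 3), ⟪U z.1 z.2 + W z.1 z.2, timeDeriv ψ z.1 z.2⟫) + (∫ z : ℝ × EuclideanSpace ℝ (Fin 3), ⟪U z.1 z.2 + W z.1 z.2,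 Δ (ψ z.1) z.2⟫) + (∫ z : ℝ × EuclideanSpace ℝ (Fin 3), p z.1 z.2 * VectorCalculus.divergence (ψ z.1) z.2) + ∫ z : ℝ × EuclideanSpace ℝ (Fin 3), ⟪(U z.1 z.2 + W z.1 z.2) + (G z.1 z.2 + fderiv ℝ (W z.1) z.2) z.2 - G z.1 z.2 (W z.1 z.2 + V z.1 z.2) - fderiv ℝ (W z.1) z.2 (U z.1 z.2 + W z.1 z.2), ψ z.1 z.2⟫ := by
    have t2 : Integrable (fun z : ℝ × EuclideanSpace ℝ (Fin 3) => ⟪U z.1 z.2 + W z.1 z.2, timeDeriv ψ z.1 z.2⟫ + ⟪U z.1 z.2 + W z.1 z.2, Δ (ψ z.1) z.2⟫) volume := hA.add hL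
    have t3 : Integrable (fun z : ℝ × EuclideanSpace ℝ (Fin 3) => ⟪U z.1 z.2 + W z.1 z.2, timeDeriv ψ z.1 z.2⟫ + ⟪U z.1 z.2 + W z.1 z.2, Δ (ψ z.1) z.2⟫ + p z.1 z.2 * VectorCalculus.divergence (ψ z.1) z.2) volume := t2.add hP
    rw [← integral_add hA hL, ← integral_add t2 hP, ← integral_add t3 hF]
  have hD := hdist ψ hψ
  rw [eM]
  rw [e3'] at e3
  rw [e4'] at e4
  linarith [hD, eD, eF, e3, e4, e5]

end StokesForm

end BradshawTsai2017

end Literature.Analysis.FluidPDE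

end
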